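import Literature.NumberTheory.Automorphic.CDTTheorem722
import Literature.NumberTheory.Automorphic.CDTTheorem722Proofs
import Literature.NumberTheory.Automorphic.CDTTheorem722ThreeFactsProofs
import Literature.NumberTheory.EllipticCurves.InertiaInvariantsAdditiveProofs
import Literature.NumberTheory.Automorphic.CDTTheorem712
import Literature.NumberTheory.Automorphic.CDTTheorem712TwoLiftsProofs
import Literature.NumberTheory.Automorphic.BCDTTheoremB
import Literature.NumberTheory.EllipticCurves.NewformsLevelEqOfHeckeEigenvalueEqProofs
import Literature.NumberTheory.EllipticCurves.NewformsEqOfHeckeEigenvalueEqProofs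
import Literature.NumberTheory.EllipticCurves.NewformsHeckeProofs
import Literature.NumberTheory.EllipticCurves.NewformGaloisRepEulerFactors
import Literature.NumberTheory.EllipticCurves.Szpiro
import Literature.NumberTheory.EllipticCurves.CuspFormTwist
import Literature.NumberTheory.EllipticCurves.HeckeOperatorsProofs
import Summits.ABC.ABC.Theorems.DefiniteXiFreyModularityIsModular
import Literature.NumberTheory.EllipticCurves.TateModuleTwistNewformEulerFactorsProofs
import Literature.NumberTheory.EllipticCurves.CuspFormLFunctionLevelConductorOfCarayolProofs
import Literature.NumberTheory.EllipticCurves.EisensteinNewformLevelRaising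
import Literature.NumberTheory.EllipticCurves.HasseWeilAbelianEulerFactorForallProofs
import Literature.NumberTheory.EllipticCurves.ModularityVersionApProofs
import Literature.NumberTheory.EllipticCurves.RootNumberAtkinLehnerSemistableProofs
import Literature.NumberTheory.GaloisRepresentations.CoinvariantsCharpolyBaseChange
import Literature.NumberTheory.EllipticCurves.TateModuleIrreducibleFrobenius
import Literature.NumberTheory.EllipticCurves.CuspFormLFunctionLevelConductorProofs
import Literature.NumberTheory.GaloisRepresentations.FramedRepBaseChange
import Literature.NumberTheory.GaloisRepresentations.OddAbsolutelyIrreducibleProofs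
import Literature.AlgebraicGeometry.Motives.FaltingsECEndCoreCasesProofs
import Literature.RepresentationTheory.IrreducibleTwistTransport
import Literature.NumberTheory.GaloisRepresentations.FramedRepEquivConj
import Literature.NumberTheory.EllipticCurves.NeronOggShafarevichProofs
import HarnessLib
import Literature.NumberTheory.DiophantineGeometry.ConductorAdditiveProofs
import Summits.ABC.ABC.Theorems.DefiniteXiFreyModularityCMCorner
import Literature.NumberTheory.DiophantineGeometry.GeneralizedFermatTwoPowerCoefficientFreySwanEightProofs
import Literature.NumberTheory.DiophantineGeometry.GeneralizedFermatTwoPowerCoefficientFreySaitoProofs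
import Literature.NumberTheory.DiophantineGeometry.GeneralizedFermatTwoPowerCoefficientFreyIsogenyProofs
import Literature.NumberTheory.DiophantineGeometry.FreyCurveConductorTwoBadSignProofs
import Literature.NumberTheory.DiophantineGeometry.FreyCurveConductorTwoTwistDichotomyProofs
import Literature.NumberTheory.DiophantineGeometry.DenesEquationFreyCurveTwoProofs
import Literature.NumberTheory.DiophantineGeometry.DenesEquationLargeExponentsProofs
import Literature.NumberTheory.DiophantineGeometry.LocalReductionProofs
import Literature.NumberTheory.EllipticCurves.QuadraticTwistSwanConductorMaxProofs
import Literature.NumberTheory.EllipticCurves.QuadraticTwistTateFormTwoProofs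
import Literature.NumberTheory.EllipticCurves.CanonicalPAdicHeightRestrictionProofs
import Literature.NumberTheory.Automorphic.BCDTModularity

/-!
# Stub ideation k = 2, generation 6 (RESHAPE), for `stub_threeImpTwo` (S9) of crux `FreyModularity`
# (stmt-ABC-11340, route-ABC-DefiniteXi) — companion of `STUB-IDEAS-stub_threeImpTwo-2.md` (gen 6).

Gen 6 = MERGE of k2 gen 5 (compatible-system recut T-C, kernel-checked, 0 sorries:
`…_2g5_Sketch.lean`) with k3 gen 5 (level-FIRST regime split of the bad Euler factors:
`…_3g5_Sketch.lean`), plus ONE new typed residual that shrinks the last named-fact debt: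

* the places of `W` split by reduction type — GOOD places: the a.e. packet (k2 M0 + M1 merge of the
  packets at the primes `3` and `5`, PROVED); ADDITIVE places: the LEVEL `N = N_W` from Carayol's
  CONDUCTOR theorem `Carayol1986_artinConductorExponent` (C_A) + Saito's `p = 2` leaf for `W`
  (k3 L0, PROVED) and `a_p(f₀) = 0 = a_p(W)` (Atkin–Lehner Thm. 3 / additive, k3 L1, PROVED);
  MULTIPLICATIVE places `p ∥ N`: ONE SIGN BIT `a_p(f₀) = a_p(W) ∈ {±1}` (k3 L2 `SteinbergSignPacket`).
* NEW: `Newform0SteinbergCoinvariants` — Carayol's Euler-factor fact `Carayol1986_eulerFactor` (C_E)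
  RESTRICTED to weight `2`, trivial character (`Γ₀(N)`-newforms) and the places `ℓ ∥ N` (the
  Steinberg / special places; in print Darmon–Diamond–Taylor Thm. 3.1 (e), first case — the
  Deligne–Rapoport / Langlands "Antwerp II" local–global statement at `p ∥ N`, pre-Carayol).
  `newform0SteinbergCoinvariants_of_carayol1986_eulerFactor` (instantiation) and — PROVED here —
  `steinbergSignPacket_of_newform0SteinbergCoinvariants` (realise the lift of `f₀` on `V_ℓ W ⊗ ℚ̄_ℓ`
  for ONE auxiliary prime `ℓ > p` with `V_ℓ W` irreducible, transport the coinvariant characteristic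
  polynomial to `L_v(W,T)` (k1's H3 with `he := refl`), read the `T`-coefficient (k1's H4)): this
  closes k3 gen 5's one unproved leaf (L2a) WITHOUT the cofinality leaf `L_A` and without C_E off `p ∥ N`.
* Glue (kernel-checked): `SigThreeImpTwoCS` (∀W, CS hypothesis) ⇐ {C_A, Saito-at-2 ∀V, residual};
  `SigThreeImpTwoFreyCS` ⇐ {C_A, residual, `FreySaitoTwo`} (+ the LANDED CM corner
  `isModular_freyCurve_of_natAbs_eq_two`); and the crux BY NAME:
  `freyModularity_of_recutCS_atoms_gen6 : (∀ σ, langlands_tunnell σ) → CDT_theorem_7_2_1 →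
  CDT_theorem_7_2_2 → CDT_three_five_switch → Carayol1986_artinConductorExponent →
  Newform0SteinbergCoinvariants → FreySaitoTwo → (skeleton's four landed Frey inputs) → FreyModularity`.
  `FreySaitoTwo` is reduced IN THIS FILE (section `FreySaitoPort` = k3 gen 3's chain, ported verbatim)
  to `FreySwanThreeOfTwoMul`, the statement of the LANDED
  `Summit.ABC.ABC.Theorems.swanConductorAt_torsion_three_freyCurve_of_two_mul` (binder only because that
  module's import chain is unbuilt on the current farm snapshot): FINAL closers
  `freyModularity_of_recutCS_atoms_gen6_final` / `…_final'` — closing set {LT, 7.2.1, 7.2.2, switch,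
  C_A, `Newform0SteinbergCoinvariants` ↔ k3 gen 6's `CarayolSteinbergGamma0` (the `iff` is PROVED here)}
  + FIVE binders that are statements of landed Theorems decls.  0 `sorry`.

[cite: CarayolASENS1986, Thm. (A), (0.5), (0.7), (0.8) (pp. 410–411)]
[cite: DarmonDiamondTaylor1995, Thm. 3.1 (d), (e) (pp. 86–87)] [cite: Saito1988, Theorem 1]
[cite: BCDTJAMS2001, Introduction ((3) ⇒ (2))] [cite: CDT1999, Thm. 7.1.2, 7.2.1, 7.2.2 (p. 556)]
[cite: DiamondShurman2005, Thm. 8.8.1, §8.8 (8.43)–(8.44), Prop. 9.6.4]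
-/

-- `Summit.<Summit>.<Problem>`: the duplicate `ABC.ABC` is the mandated namespace (CONVENTIONS §2).
set_option linter.dupNamespace false

noncomputable section

/-! ## FreySaitoPort — k3 gen 3's Saito-at-2 chain on the Frey family, ported VERBATIM from
`Cruxes/FreyModularity/STUB_IDEAS_stub_threeImpTwo_3g3_Sketch.lean` (lines 62–447; elaborates today,
re-checked 2026-08-31) so that `FreySaitoTwo` is reduced IN THIS FILE to the statement of the LANDED
`Summit.ABC.ABC.Theorems.swanConductorAt_torsion_three_freyCurve_of_two_mul` (`FreySwanThreeOfTwoMul`). -/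

namespace Summit.ABC.ABC.Cruxes.FreyModularity.Sketch.StubIdeasThreeImpTwo2G6.FreySaitoPort

open scoped NumberField
open IsDedekindDomain WeierstrassCurve Rat.HeightOneSpectrum
open Literature.NumberTheory.EllipticCurves Literature.NumberTheory.EllipticCurves.ModularForms
open Literature.NumberTheory.GaloisRepresentations Literature.NumberTheory.DiophantineGeometry
open Literature.NumberTheory.Automorphic

attribute [local instance] AddSubgroup.torsionBy.zmodModule

variable {A B : ℤ}

/-! ## The place `v₂` of `𝓞 ℚ` above `2` -/

/-- `2 ∈ v₂`. [folklore] -/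
theorem two_mem_v₂ : (2 : 𝓞 ℚ) ∈ ((primesEquiv (R := 𝓞 ℚ)).symm ⟨2, Nat.prime_two⟩).asIdeal := by
  have := (natCast_mem_asIdeal_iff_eq_primesEquiv_symm
    ((primesEquiv (R := 𝓞 ℚ)).symm ⟨2, Nat.prime_two⟩) Nat.prime_two).mpr rfl
  exact_mod_cast this

/-- `3 ∉ v₂`. [folklore] -/
theorem three_notMem_v₂ :
    ((3 : ℕ) : 𝓞 ℚ) ∉ ((primesEquiv (R := 𝓞 ℚ)).symm ⟨2, Nat.prime_two⟩).asIdeal :=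
  Ribet1997.three_notMem_of_two_mem two_mem_v₂

/-! ## Row "bad sign, `4 ∣ B`, `16 ∤ B`" (Kodaira `I₀*` / `I₂*`, `f₂ = 4`, `δ₂ = 2`) -/

/-- **H1 — `Sw_𝔓(E[3]) = 2` for the bad-sign additive Frey curves, by the twist-max formula, no fake
points.**  `E_(A,B) = (E_(−A,−B))^{(−1)}` (`quadraticTwist_freyCurve_neg_one`, `freyCurve_swap`),
`E_(−A,−B)` is a good-sign curve with `Sw = 1` (`exists_swanConductorAt_torsion_three_freyCurve_of_sixteen_not_dvd`),
and `−1 ≡ 3 (mod 4)` gives `Sw(E^{(−1)}[3]) = max (1, 2) = 2`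
(`Rat.swanConductorAt_torsion_quadraticTwist_eq_max_two_of_emod_four_eq_three`). (gen 2, PROVED) -/
theorem exists_swanConductorAt_torsion_three_freyCurve_badSign (h0 : A * B * (A + B) ≠ 0)
    (hA : A ≡ 1 [ZMOD 4]) (h4 : (4 : ℤ) ∣ B) (h16 : ¬ (16 : ℤ) ∣ B) :
    ∃ 𝔓 ∈ ((primesEquiv (R := 𝓞 ℚ)).symm ⟨2, Nat.prime_two⟩).primesAbove,
      ((freyCurve A B).torsionGaloisRep 3).swanConductorAt (𝓞 ℚ) 𝔓 = 2 := by
  -- the good-sign partner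
  have h0' : (-A) * (-B) * (-A + -B) ≠ 0 := by
    intro h; apply h0; nlinarith [h]
  have hA' : -A ≡ -1 [ZMOD 4] := by unfold Int.ModEq at hA ⊢; omega
  have h4' : (4 : ℤ) ∣ -B := (dvd_neg).mpr h4
  have h16' : ¬ (16 : ℤ) ∣ -B := fun h ↦ h16 ((dvd_neg).mp h)
  obtain ⟨𝔓, h𝔓, hSw⟩ :=
    exists_swanConductorAt_torsion_three_freyCurve_of_sixteen_not_dvd h0' hA' h4' h16'
  haveI : (freyCurve (-A) (-B)).IsElliptic := isElliptic_freyCurve h0'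
  have key := Rat.swanConductorAt_torsion_quadraticTwist_eq_max_two_of_emod_four_eq_three
    (freyCurve (-A) (-B)) 3 (by decide) (d := -1) (by decide) two_mem_v₂ three_notMem_v₂ h𝔓
    (by rw [hSw]; norm_num) (by rw [hSw]; norm_num)
  rw [hSw] at key
  have htw : (freyCurve (-A) (-B)).quadraticTwist (((-1 : ℤ) : ℚ)) = freyCurve A B := by
    rw [Int.cast_neg, Int.cast_one, quadraticTwist_freyCurve_neg_one, freyCurve_swap, neg_neg, neg_neg]
  rw [htw] at key
  refine ⟨𝔓, h𝔓, ?_⟩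
  rw [key]
  norm_num

/-- **H2 — `δ₂ = 2` in the bad sign** (places of `ℤ`): Kodaira `I₀*` (`4 ∥ B`) resp. `I₂*` (`8 ∥ B`),
`f₂ = 4` (`kodairaSymbolAt_freyCurve_two_of_{four,eight}_dvd_of_four_dvd_sub_one`, Diamond–Kramer's
rows twisted by `ℚ(i)`), `ε₂ = 2`. [cite: DiamondKramer1995, Lemma 1 and Lemma 2, p. 300] -/
theorem wildConductorExponent_freyCurve_two_eq_two (v : HeightOneSpectrum ℤ)
    (hv : natGenerator v = 2) (h0 : A * B * (A + B) ≠ 0) (hA : A ≡ 1 [ZMOD 4]) (h4 : (4 : ℤ) ∣ B)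
    (h16 : ¬ (16 : ℤ) ∣ B) : (freyCurve A B).wildConductorExponent v = 2 := by
  have hA' : 4 ∣ A - 1 := Int.ModEq.dvd hA.symm
  obtain ⟨b₀, hb₀⟩ := h4
  unfold WeierstrassCurve.wildConductorExponent
  by_cases h2 : (2 : ℤ) ∣ b₀
  · obtain ⟨b, hb⟩ := h2
    have hbodd : ¬ (2 : ℤ) ∣ b := fun ⟨e, he⟩ ↦ h16 ⟨e, by rw [hb₀, hb, he]; ring⟩
    obtain ⟨hK, -, hf⟩ := kodairaSymbolAt_freyCurve_two_of_eight_dvd_of_four_dvd_sub_one v hv h0 hA'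
      (b := b) (by rw [hb₀, hb]; ring) hbodd
    rw [hK, hf]
    rfl
  · obtain ⟨hK, -, hf⟩ :=
      kodairaSymbolAt_freyCurve_two_of_four_dvd_of_four_dvd_sub_one v hv h0 hA' hb₀ h2
    rw [hK, hf]
    rfl

/-- H2 at the place of `𝓞 ℚ` above `2` (transport `wildConductorExponent_eq_of_primesEquiv_eq`).
[cite: DiamondKramer1995, Lemma 1 and Lemma 2, p. 300] -/
theorem wildConductorExponent_freyCurve_two_eq_two_ringOfIntegers (v : HeightOneSpectrum (𝓞 ℚ))
    (hv : (2 : 𝓞 ℚ) ∈ v.asIdeal) (h0 : A * B * (A + B) ≠ 0) (hA : A ≡ 1 [ZMOD 4])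
    (h4 : (4 : ℤ) ∣ B) (h16 : ¬ (16 : ℤ) ∣ B) : (freyCurve A B).wildConductorExponent v = 2 := by
  haveI := isElliptic_freyCurve h0
  set v₂ : HeightOneSpectrum ℤ := (primesEquiv (R := ℤ)).symm ⟨2, Nat.prime_two⟩ with hv₂
  have hv₂' : natGenerator v₂ = 2 :=
    Literature.NumberTheory.EllipticCurves.Rat.natGenerator_primesEquiv_symm ⟨2, Nat.prime_two⟩
  have hvv : (primesEquiv (R := ℤ) v₂ : Nat.Primes) = primesEquiv (R := 𝓞 ℚ) v := by
    apply Subtype.ext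
    change natGenerator v₂ = natGenerator v
    rw [hv₂', Literature.NumberTheory.GaloisRepresentations.Rat.natGenerator_eq_two hv]
  rw [← wildConductorExponent_eq_of_primesEquiv_eq v₂ v (freyCurve A B) hvv]
  exact wildConductorExponent_freyCurve_two_eq_two v₂ hv₂' h0 hA h4 h16

/-! ## Row "`2 ∥ B`" (Kodaira `III`, `f₂ = 5`, `δ₂ = 3`, either sign) -/

/-- **H3 — `δ₂ = 3` for `2 ∥ B`, `A` odd** (places of `ℤ`): Kodaira `III`, `f₂ = 5`
(`kodairaSymbolAt_freyCurve_two_of_two_dvd`), `ε₂ = 2`. [cite: DiamondKramer1995, Lemma 2]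
[cite: DarmonMerel1997, Prop. 1.1 (1)] -/
theorem wildConductorExponent_freyCurve_two_eq_three_of_two_mul_int (v : HeightOneSpectrum ℤ)
    (hv : natGenerator v = 2) (h0 : A * B * (A + B) ≠ 0) (hA : ¬ (2 : ℤ) ∣ A) {b : ℤ}
    (hB : B = 2 * b) (hb : ¬ (2 : ℤ) ∣ b) : (freyCurve A B).wildConductorExponent v = 3 := by
  unfold WeierstrassCurve.wildConductorExponent
  obtain ⟨hK, -, hf⟩ := kodairaSymbolAt_freyCurve_two_of_two_dvd v hv h0 hA hB hb
  rw [hK, hf]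
  rfl

/-- H3 at the place of `𝓞 ℚ` above `2`. [cite: DiamondKramer1995, Lemma 2] -/
theorem wildConductorExponent_freyCurve_two_eq_three_of_two_mul (v : HeightOneSpectrum (𝓞 ℚ))
    (hv : (2 : 𝓞 ℚ) ∈ v.asIdeal) (h0 : A * B * (A + B) ≠ 0) (hA : ¬ (2 : ℤ) ∣ A) {b : ℤ}
    (hB : B = 2 * b) (hb : ¬ (2 : ℤ) ∣ b) : (freyCurve A B).wildConductorExponent v = 3 := by
  haveI := isElliptic_freyCurve h0
  set v₂ : HeightOneSpectrum ℤ := (primesEquiv (R := ℤ)).symm ⟨2, Nat.prime_two⟩ with hv₂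
  have hv₂' : natGenerator v₂ = 2 :=
    Literature.NumberTheory.EllipticCurves.Rat.natGenerator_primesEquiv_symm ⟨2, Nat.prime_two⟩
  have hvv : (primesEquiv (R := ℤ) v₂ : Nat.Primes) = primesEquiv (R := 𝓞 ℚ) v := by
    apply Subtype.ext
    change natGenerator v₂ = natGenerator v
    rw [hv₂', Literature.NumberTheory.GaloisRepresentations.Rat.natGenerator_eq_two hv]
  rw [← wildConductorExponent_eq_of_primesEquiv_eq v₂ v (freyCurve A B) hvv]
  exact wildConductorExponent_freyCurve_two_eq_three_of_two_mul_int v₂ hv₂' h0 hA hB hb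

/-- **H4a — the second even presentation**: translating the root `−B` to the origin (`x ↦ x − B`,
`(u, r, s, t) = (1, −B, 0, 0)`), `E_(A,B) ≅ E_(A+B,−B)`; for `2 ∥ B` it flips the class of the odd
root mod `4`. [cite: SilvermanAEC2009, III.1 Table 3.1] -/
theorem translate_freyCurve' (A B : ℤ) :
    (⟨1, -(B : ℚ), 0, 0⟩ : VariableChange ℚ) • freyCurve A B = freyCurve (A + B) (-B) := by
  ext
  · simp only [variableChange_a₁, freyCurve_a₁, Units.val_one, inv_one]; ring
  · simp only [variableChange_a₂, freyCurve_a₁, freyCurve_a₂, Units.val_one, inv_one, Int.cast_neg,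
      Int.cast_add]; ring
  · simp only [variableChange_a₃, freyCurve_a₁, freyCurve_a₃, Units.val_one, inv_one]; ring
  · simp only [variableChange_a₄, freyCurve_a₁, freyCurve_a₂, freyCurve_a₃, freyCurve_a₄,
      Units.val_one, inv_one, Int.cast_neg, Int.cast_add]; ring
  · simp only [variableChange_a₆, freyCurve_a₁, freyCurve_a₂, freyCurve_a₃, freyCurve_a₄,
      freyCurve_a₆, Units.val_one, inv_one]; ring

/-- **The good-sign `2 ∥ B` Swan value, as a named hypothesis.**  This is VERBATIM the type of the
landed theorem `Summit.ABC.ABC.Theorems.swanConductorAt_torsion_three_freyCurve_of_two_mul`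
(`Summits/ABC/ABC/Theorems/DefiniteXiFreyModularityStubFreySwanOdd.lean`, from the fake-point class
files `D6C4C7M8R7M2R1` / `D6C4Cge8M8R3`); it is a hypothesis here only because that module was
unbuilt on the Lean farm at publication time. [cite: DiamondKramer1995, Lemma 2] -/
def FreySwanThreeOfTwoMul : Prop :=
  ∀ {A B : ℤ}, A * B * (A + B) ≠ 0 → A ≡ -1 [ZMOD 4] → ∀ {b : ℤ}, B = 2 * b → Odd b →
    2 * A + B ≠ 0 → ∀ {v : HeightOneSpectrum (𝓞 ℚ)}, (2 : 𝓞 ℚ) ∈ v.asIdeal →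
      ∀ {𝔓 : Ideal (absIntegers (𝓞 ℚ) ℚ)}, 𝔓 ∈ v.primesAbove →
        ((freyCurve A B).torsionGaloisRep 3).swanConductorAt (𝓞 ℚ) 𝔓 = 3

/-- **H4 — `Sw_𝔓(E[3]) = 3` for `2 ∥ B` and EITHER sign of `A`** (`A` odd, `2A + B ≠ 0`), at every
`𝔓 ∣ v₂`, from the good-sign value `hOdd` (= the landed
`Summit.ABC.ABC.Theorems.swanConductorAt_torsion_three_freyCurve_of_two_mul`); bad sign `A ≡ 1` goes
through H4a (`A + B ≡ −1 (mod 4)`, `−B = 2(−b)`, `2(A+B) + (−B) = 2A + B`) and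
`swanConductorAt_torsion_eq_of_smul_eq`. [cite: DiamondKramer1995, Lemma 2] -/
theorem swanConductorAt_torsion_three_freyCurve_of_two_mul' (hOdd : FreySwanThreeOfTwoMul)
    (h0 : A * B * (A + B) ≠ 0)
    (hA : ¬ (2 : ℤ) ∣ A) {b : ℤ} (hB : B = 2 * b) (hb : ¬ (2 : ℤ) ∣ b) (h2AB : 2 * A + B ≠ 0)
    {𝔓 : Ideal (absIntegers (𝓞 ℚ) ℚ)}
    (h𝔓 : 𝔓 ∈ ((primesEquiv (R := 𝓞 ℚ)).symm ⟨2, Nat.prime_two⟩).primesAbove) :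
    ((freyCurve A B).torsionGaloisRep 3).swanConductorAt (𝓞 ℚ) 𝔓 = 3 := by
  have hbodd : Odd b := Int.not_even_iff_odd.mp (fun h ↦ hb (even_iff_two_dvd.mp h))
  by_cases hs : A ≡ -1 [ZMOD 4]
  · exact hOdd h0 hs hB hbodd h2AB two_mem_v₂ h𝔓
  · -- bad sign: pass to the presentation `E_(A+B,−B)`
    have hs' : A + B ≡ -1 [ZMOD 4] := by
      obtain ⟨m, hm⟩ := hbodd; unfold Int.ModEq at hs ⊢; omega
    have h0' : (A + B) * (-B) * ((A + B) + (-B)) ≠ 0 := by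
      intro h; apply h0; linear_combination -h
    have hBm : -B = 2 * (-b) := by rw [hB]; ring
    have h2AB' : 2 * (A + B) + (-B) ≠ 0 := by
      intro h; apply h2AB; linear_combination h
    haveI := isElliptic_freyCurve h0
    haveI := isElliptic_freyCurve h0'
    rw [swanConductorAt_torsion_eq_of_smul_eq (translate_freyCurve' A B) 3 three_notMem_v₂ h𝔓]
    exact hOdd h0' hs' hBm hbodd.neg h2AB' two_mem_v₂ h𝔓

/-! ## Row "`16 ∣ B`": `ord₂ j ≤ 0`, the `j`-engine's hypothesis `|j|₂ < 1` is void -/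

/-- `A² + AB + B²` is odd for `A` odd, `B` even. [folklore] -/
theorem not_two_dvd_sq_add_mul_add_sq (hA : ¬ (2 : ℤ) ∣ A) (h2 : (2 : ℤ) ∣ B) :
    ¬ (2 : ℤ) ∣ A ^ 2 + A * B + B ^ 2 := by
  have hBeven : Even B := even_iff_two_dvd.mpr h2
  have hAodd : Odd A := Int.not_even_iff_odd.mp (fun h ↦ hA (even_iff_two_dvd.mp h))
  have hNodd : Odd (A ^ 2 + A * B + B ^ 2) :=
    (hAodd.pow.add_even (hBeven.mul_left A)).add_even (hBeven.pow_of_ne_zero two_ne_zero)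
  exact fun h ↦ Int.not_even_iff_odd.mpr hNodd (even_iff_two_dvd.mpr h)

/-- **`ord₂ j(E_(A,B)) = 8 − 2 ord₂ (AB(A+B))` for `A` odd, `B` even**:
`j = 2⁸ (A² + AB + B²)³ / (AB(A+B))²` (`j_freyCurve`) with `A² + AB + B²` odd.
[cite: Serre1987, §4.1 (4.1.9)] [cite: DiamondKramer1995, Lemma 1] -/
theorem padicValRat_j_freyCurve_of_two_dvd [(freyCurve A B).IsElliptic] (h0 : A * B * (A + B) ≠ 0)
    (hA : ¬ (2 : ℤ) ∣ A) (h2 : (2 : ℤ) ∣ B) :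
    padicValRat 2 (freyCurve A B).j = 8 - 2 * (padicValInt 2 (A * B * (A + B)) : ℤ) := by
  have hN2 := not_two_dvd_sq_add_mul_add_sq hA h2
  have hN0 : A ^ 2 + A * B + B ^ 2 ≠ 0 := fun h ↦ hN2 (by rw [h]; exact dvd_zero 2)
  have hvN : padicValInt 2 (A ^ 2 + A * B + B ^ 2) = 0 :=
    padicValInt.eq_zero_of_not_dvd (by exact_mod_cast hN2)
  have h22 : padicValRat 2 (2 : ℚ) = 1 := by exact_mod_cast padicValRat.self (p := 2) one_lt_two
  have e1 : ((A : ℚ) ^ 2 + A * B + B ^ 2) = ((A ^ 2 + A * B + B ^ 2 : ℤ) : ℚ) := by push_cast; ring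
  have e2 : ((A : ℚ) * B * (A + B)) = ((A * B * (A + B) : ℤ) : ℚ) := by push_cast; ring
  have hNq : ((A ^ 2 + A * B + B ^ 2 : ℤ) : ℚ) ≠ 0 := by exact_mod_cast hN0
  have hDq : ((A * B * (A + B) : ℤ) : ℚ) ≠ 0 := by exact_mod_cast h0
  rw [j_freyCurve h0, e1, e2,
    padicValRat.div (mul_ne_zero (by norm_num) (pow_ne_zero _ hNq)) (pow_ne_zero _ hDq),
    padicValRat.mul (by norm_num) (pow_ne_zero _ hNq), padicValRat.pow, padicValRat.pow,
    padicValRat.pow, padicValRat.of_int, padicValRat.of_int, hvN, h22]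
  push_cast
  ring

/-- **H5 — `1 ≤ |j(E_(A,B))|_{v₂}` (i.e. `ord₂ j ≤ 0`) for `A` odd, `16 ∣ B`**: `ord₂ j = 8 − 2 ord₂ B
≤ 0`; read at the place `v₂` via `valuation_ratCast_eq_one_of_padicValRat_eq_zero` /
`one_lt_valuation_ratCast_of_padicValRat_neg`.  These curves are semistable at `2` (good sign) or the
`ℚ(i)`-twist `I*_{2k−4}` of one (bad sign) — potentially multiplicative / good, never potentially
supersingular. [cite: DiamondKramer1995, Lemma 1] [cite: SilvermanAEC2009, Prop. VII.5.5] -/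
theorem one_le_valuation_j_freyCurve_of_sixteen_dvd [(freyCurve A B).IsElliptic]
    (h0 : A * B * (A + B) ≠ 0) (hA : ¬ (2 : ℤ) ∣ A) (h16 : (16 : ℤ) ∣ B) :
    1 ≤ ((primesEquiv (R := 𝓞 ℚ)).symm ⟨2, Nat.prime_two⟩).valuation ℚ (freyCurve A B).j := by
  have h2B : (2 : ℤ) ∣ B := dvd_trans (by norm_num) h16
  have hkey := padicValRat_j_freyCurve_of_two_dvd h0 hA h2B
  have hdvd : ((2 : ℕ) : ℤ) ^ 4 ∣ A * B * (A + B) := by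
    have e : ((2 : ℕ) : ℤ) ^ 4 = 16 := by norm_num
    rw [e]; exact (h16.mul_left A).mul_right (A + B)
  have h4 : 4 ≤ padicValInt 2 (A * B * (A + B)) := by
    rcases (padicValInt_dvd_iff (p := 2) 4 (A * B * (A + B))).mp hdvd with h | h
    · exact absurd h h0
    · exact h
  have hle : padicValRat 2 (freyCurve A B).j ≤ 0 := by rw [hkey]; omega
  have hj0 : (freyCurve A B).j ≠ 0 := by
    have hN0 : A ^ 2 + A * B + B ^ 2 ≠ 0 := fun h ↦
      not_two_dvd_sq_add_mul_add_sq hA h2B (by rw [h]; exact dvd_zero 2)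
    have hNq : ((A : ℚ) ^ 2 + A * B + B ^ 2) ≠ 0 := by exact_mod_cast hN0
    have hDq : ((A : ℚ) * B * (A + B)) ≠ 0 := by exact_mod_cast h0
    rw [j_freyCurve h0]
    exact div_ne_zero (mul_ne_zero (by norm_num) (pow_ne_zero _ hNq)) (pow_ne_zero _ hDq)
  have h2v : ((2 : ℕ) : 𝓞 ℚ) ∈ ((primesEquiv (R := 𝓞 ℚ)).symm ⟨2, Nat.prime_two⟩).asIdeal := by
    exact_mod_cast two_mem_v₂
  rcases hle.eq_or_lt with h | h
  · have := valuation_ratCast_eq_one_of_padicValRat_eq_zero (K := ℚ) Nat.prime_two h2v hj0 h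
    rw [Rat.cast_id] at this
    exact this.symm.le
  · have := one_lt_valuation_ratCast_of_padicValRat_neg (K := ℚ) Nat.prime_two h2v h
    rw [Rat.cast_id] at this
    exact this.le

/-! ## Assembly: Saito's `p = 2` leaf for every Frey curve off the CM corner -/

/-- **H6 — Saito at `2` for every even presentation** (`A` odd, `2 ∣ B`, `AB(A+B) ≠ 0`,
`2A + B ≠ 0`), every `ℓ`: the engine
`swanConductorAt_rationalTate_eq_wildConductorExponent_of_ringChar_eq_two_of_valuation_j_lt_one` fed
row by row — `16 ∣ B`: H5 makes `|j|₂ < 1` absurd; `4 ∣ B`, `16 ∤ B`: good sign `Sw = 1 = δ₂`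
(tree), bad sign H1 + H2; `2 ∥ B`: H4 + H3.
[cite: SilvermanATAEC1994, Thm. IV.11.1 (PDF p. 365; p. 366 for p = 2)] [cite: Saito1988, Theorem 1]
[cite: DiamondKramer1995, Lemmas 1–2] -/
theorem freySaito_of_even (hOdd : FreySwanThreeOfTwoMul) (ℓ : ℕ) [Fact ℓ.Prime]
    (h0 : A * B * (A + B) ≠ 0) (hA : ¬ (2 : ℤ) ∣ A) (h2 : (2 : ℤ) ∣ B) (h2AB : 2 * A + B ≠ 0) :
    (freyCurve A B).swanConductorAt_rationalTate_eq_wildConductorExponent_of_ringChar_eq_two ℓ := by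
  -- NB (elaboration): `ℓ [Fact ℓ.Prime]` come FIRST — a term of the (instance-headed) Saito def
  -- produced right after an instance binder gets over-applied by the app elaborator.
  refine (freyCurve A B).swanConductorAt_rationalTate_eq_wildConductorExponent_of_ringChar_eq_two_of_valuation_j_lt_one
    ℓ ?_
  intro _ _hadd hj
  by_cases h16 : (16 : ℤ) ∣ B
  · exact absurd hj (not_lt.mpr (one_le_valuation_j_freyCurve_of_sixteen_dvd h0 hA h16))
  by_cases h4 : (4 : ℤ) ∣ B
  · by_cases hs : A ≡ -1 [ZMOD 4]
    · obtain ⟨𝔓, h𝔓, hSw⟩ :=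
        exists_swanConductorAt_torsion_three_freyCurve_of_sixteen_not_dvd h0 hs h4 h16
      refine ⟨𝔓, h𝔓, ?_⟩
      rw [hSw, wildConductorExponent_freyCurve_two_eq_one_ringOfIntegers _ two_mem_v₂ h0 hs h4 h16,
        Nat.cast_one]
    · have hs' : A ≡ 1 [ZMOD 4] := by unfold Int.ModEq at hs ⊢; omega
      obtain ⟨𝔓, h𝔓, hSw⟩ := exists_swanConductorAt_torsion_three_freyCurve_badSign h0 hs' h4 h16
      refine ⟨𝔓, h𝔓, ?_⟩
      rw [hSw, wildConductorExponent_freyCurve_two_eq_two_ringOfIntegers _ two_mem_v₂ h0 hs' h4 h16]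
      norm_num
  · obtain ⟨b, hb⟩ := h2
    have hbodd : ¬ (2 : ℤ) ∣ b := fun ⟨c, hc⟩ ↦ h4 ⟨c, by rw [hb, hc]; ring⟩
    obtain ⟨𝔓, h𝔓⟩ := HeightOneSpectrum.primesAbove_nonempty
      ((primesEquiv (R := 𝓞 ℚ)).symm ⟨2, Nat.prime_two⟩)
    refine ⟨𝔓, h𝔓, ?_⟩
    rw [swanConductorAt_torsion_three_freyCurve_of_two_mul' hOdd h0 hA hb hbodd h2AB h𝔓,
      wildConductorExponent_freyCurve_two_eq_three_of_two_mul _ two_mem_v₂ h0 hA hb hbodd]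
    norm_num

/-- **H7a — the named Saito leaf is an isomorphism invariant** (`C • W = W'`):
`swanConductorAt_rationalTate_variableChange` + `wildConductorExponent_smul'` +
`hasAdditiveReductionAt_smul_iff_holds`, as inlined in `OggFormulaJZeroTwoProofs`.
[cite: SilvermanATAEC1994, §IV.10 (the conductor is an invariant of E)] -/
theorem saitoTwo_of_smul_eq {W W' : WeierstrassCurve ℚ} [W.IsElliptic] {C : VariableChange ℚ}
    (e : C • W = W') (ℓ : ℕ) [Fact ℓ.Prime]
    (h : W'.swanConductorAt_rationalTate_eq_wildConductorExponent_of_ringChar_eq_two ℓ) :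
    W.swanConductorAt_rationalTate_eq_wildConductorExponent_of_ringChar_eq_two ℓ := by
  subst e
  intro _ hc v hℓ hadd h2 𝔓 h𝔓
  haveI := perfectField_residueField_adicCompletionIntegers (K := ℚ) v
  have hadd' : (C • W).HasAdditiveReductionAt v :=
    (hasAdditiveReductionAt_smul_iff_holds v W C).mpr hadd
  have hc' := (C • W).continuous_rationalGaloisRepTate_holds ℓ
  rw [← wildConductorExponent_smul' v W C,
    ← W.swanConductorAt_rationalTate_variableChange C ℓ hc hc' hℓ h𝔓]
  exact h hc' v hℓ hadd' h2 h𝔓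

/-- **Off the CM corner, `2a + b ≠ 0` for coprime `a, b`** (`2a + b = 0` forces `a = ±1`,
`(a, b) = (±1, ∓2)`, `|ab(a+b)| = 2`). [folklore] -/
theorem two_mul_add_ne_zero_of_natAbs_ne_two {a b : ℤ} (hab : IsCoprime a b)
    (hc : (a * b * (a + b)).natAbs ≠ 2) : 2 * a + b ≠ 0 := by
  intro h
  have hb : b = -2 * a := by linear_combination h
  subst hb
  rcases Int.isUnit_iff.mp (hab.isUnit_of_dvd' dvd_rfl ⟨-2, by ring⟩) with rfl | rfl <;>
    exact hc (by decide)

/-- **Off the CM corner, `b − a ≠ 0` for coprime `a, b`** (`a = b` forces `a = ±1`,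
`(a, b) = (±1, ±1)`). [folklore] -/
theorem sub_ne_zero_of_natAbs_ne_two {a b : ℤ} (hab : IsCoprime a b)
    (hc : (a * b * (a + b)).natAbs ≠ 2) : b - a ≠ 0 := by
  intro h
  have hb : b = a := by linear_combination h
  subst hb
  rcases Int.isUnit_iff.mp (hab.isUnit_of_dvd' dvd_rfl dvd_rfl) with rfl | rfl <;>
    exact hc (by decide)

/-- **H7 — Saito's `p = 2` leaf for EVERY Frey curve off the CM corner** (`a ⊥ b`, `ab(a+b) ≠ 0`,
`|ab(a+b)| ≠ 2`), every `ℓ`.  Presentations: `b` even → H6 verbatim (`2a + b ≠ 0` off-corner);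
`a` even → `freyCurve a b = freyCurve (−b) (−a)` (`freyCurve_swap`), H6; `a, b` odd →
`translate_freyCurve a b : E_(a,b) ≅ E_(−a,a+b)` + H7a + H6 (`2(−a) + (a+b) = b − a ≠ 0`
off-corner).  The six corner pairs `(±1,±1), (±1,∓2), (±2,∓1)` (`E ≅ 32a2`, `j = 1728`, `c₆ = 0`)
are exactly where no `2`-adic class theorem of the tree applies; they are bypassed in
`threeImpTwo_freyCurve` by the landed corner modularity.
[cite: SilvermanATAEC1994, Thm. IV.11.1 (PDF p. 365; p. 366 for p = 2)] [cite: Saito1988, Theorem 1]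
[cite: DiamondKramer1995, Lemmas 1–2] -/
theorem freySaito (hOdd : FreySwanThreeOfTwoMul) (a b : ℤ) (ℓ : ℕ) [Fact ℓ.Prime]
    (hab : IsCoprime a b) (h0 : a * b * (a + b) ≠ 0) (hc : (a * b * (a + b)).natAbs ≠ 2) :
    (freyCurve a b).swanConductorAt_rationalTate_eq_wildConductorExponent_of_ringChar_eq_two ℓ := by
  -- NB (elaboration): no `haveI`/`by_cases` here and explicit hypotheses last (see H6).
  rcases em ((2 : ℤ) ∣ b) with hb | hb
  · -- `b` even, `a` odd
    have ha : ¬ (2 : ℤ) ∣ a := fun ha ↦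
      Int.prime_two.not_unit (hab.isUnit_of_dvd' ha hb)
    -- (fully explicit `@`: a bare `exact freySaito_of_even …` makes the app elaborator unfold the
    -- instance-headed Saito def and ask for `(freyCurve a b).IsElliptic`)
    exact @freySaito_of_even a b hOdd ℓ _ h0 ha hb (two_mul_add_ne_zero_of_natAbs_ne_two hab hc)
  rcases em ((2 : ℤ) ∣ a) with ha | ha
  · -- `a` even, `b` odd: the presentation `E_(−b,−a)`
    have hc' : (b * a * (b + a)).natAbs ≠ 2 := by
      rwa [show b * a * (b + a) = a * b * (a + b) by ring]
    have hne := two_mul_add_ne_zero_of_natAbs_ne_two hab.symm hc'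
    have h0' : (-b) * (-a) * (-b + -a) ≠ 0 := by intro h; apply h0; linear_combination -h
    have hb' : ¬ (2 : ℤ) ∣ -b := fun h ↦ hb (dvd_neg.mp h)
    have ha' : (2 : ℤ) ∣ -a := dvd_neg.mpr ha
    have hne' : 2 * (-b) + (-a) ≠ 0 := by intro h; apply hne; linear_combination -h
    rw [show freyCurve a b = freyCurve (-b) (-a) from freyCurve_swap b a]
    exact @freySaito_of_even (-b) (-a) hOdd ℓ _ h0' hb' ha' hne'
  · -- `a`, `b` odd: the presentation `E_(−a,a+b)` by translation
    have hne := sub_ne_zero_of_natAbs_ne_two hab hc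
    have h0' : (-a) * (a + b) * (-a + (a + b)) ≠ 0 := by intro h; apply h0; linear_combination -h
    have ha' : ¬ (2 : ℤ) ∣ -a := fun h ↦ ha (dvd_neg.mp h)
    have hab' : (2 : ℤ) ∣ a + b := by
      have hao : Odd a := Int.not_even_iff_odd.mp (fun h ↦ ha (even_iff_two_dvd.mp h))
      have hbo : Odd b := Int.not_even_iff_odd.mp (fun h ↦ hb (even_iff_two_dvd.mp h))
      exact even_iff_two_dvd.mp (hao.add_odd hbo)
    have hne' : 2 * (-a) + (a + b) ≠ 0 := by intro h; apply hne; linear_combination h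
    exact @saitoTwo_of_smul_eq (freyCurve a b) (freyCurve (-a) (a + b)) (isElliptic_freyCurve h0) _
      (translate_freyCurve a b) ℓ _ (freySaito_of_even hOdd ℓ h0' ha' hab' hne')

/-- H7 in the shape `IsNewformOf.level_eq_conductorNorm_of_carayol1986_of_saito` consumes
(`hS : ∀ ℓ [Fact ℓ.Prime], W.⟨Saito leaf⟩ ℓ`). [cite: Saito1988, Theorem 1] -/
theorem freySaito_forall (hOdd : FreySwanThreeOfTwoMul) (a b : ℤ) (hab : IsCoprime a b)
    (h0 : a * b * (a + b) ≠ 0) (hc : (a * b * (a + b)).natAbs ≠ 2) :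
    ∀ (ℓ : ℕ) [Fact ℓ.Prime],
      (freyCurve a b).swanConductorAt_rationalTate_eq_wildConductorExponent_of_ringChar_eq_two ℓ := by
  intro ℓ _
  exact freySaito hOdd a b ℓ hab h0 hc

end Summit.ABC.ABC.Cruxes.FreyModularity.Sketch.StubIdeasThreeImpTwo2G6.FreySaitoPort


open scoped NumberField Polynomial MatrixGroups ModularForm
open NumberField IsDedekindDomain IsDedekindDomain.HeightOneSpectrum Field Polynomial
open CongruenceSubgroup Rat.HeightOneSpectrum
open Literature.NumberTheory.EllipticCurves
open Literature.NumberTheory.EllipticCurves.ModularForms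
open Literature.NumberTheory.Automorphic
open Literature.NumberTheory.Automorphic.BCDT
open Literature.NumberTheory.GaloisRepresentations
open WeierstrassCurve

namespace Summit.ABC.ABC.Cruxes.FreyModularity.Sketch.StubIdeasThreeImpTwo2G6

/-! ## The stub (verbatim) and the compatible-system cuts -/

/-- The registered stub S9, verbatim. -/
def SigStubThreeImpTwo : Prop :=
  ∀ (W : WeierstrassCurve ℚ) [W.IsElliptic] [NeZero (W.conductorNorm ℤ)] (ℓ : ℕ) [Fact ℓ.Prime],
    W.IsModularGaloisRepTate ℓ → BCDT.IsModular W

/-- BCDT condition (4): `ρ_{E,p}` is modular for EVERY prime `p` (the compatible system). -/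
def IsModularGaloisRepTateAll (W : WeierstrassCurve ℚ) : Prop :=
  ∀ (p : ℕ) [Fact p.Prime], W.IsModularGaloisRepTate p

/-- `h32CS` — S9 with the compatible-system hypothesis (∀W). -/
def SigThreeImpTwoCS : Prop :=
  ∀ (W : WeierstrassCurve ℚ) [W.IsElliptic] [NeZero (W.conductorNorm ℤ)],
    IsModularGaloisRepTateAll W → BCDT.IsModular W

/-- `h32FCS` — the same on Frey curves only (consumers I1, I3). -/
def SigThreeImpTwoFreyCS : Prop :=
  ∀ (a b : ℤ), IsCoprime a b → a * b * (a + b) ≠ 0 →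
    ∀ [(freyCurve a b).IsElliptic] [NeZero ((freyCurve a b).conductorNorm ℤ)],
      IsModularGaloisRepTateAll (freyCurve a b) → BCDT.IsModular (freyCurve a b)

/-- S1b with compatible-system OUTPUT (what `R = T` at `3` + Eichler–Shimura at every `p` prints). -/
def SigLiftThreeCS : Prop :=
  ∀ (W : WeierstrassCurve ℚ) [W.IsElliptic] (ρ : ModPGaloisRep ℚ (ZMod 3) 2),
    W.IsTorsionGaloisRep 3 ρ → ρ.IsAbsIrreducibleOverSqrt (-3) → ¬ 9 ∣ W.conductorNorm ℤ →
    ρ.IsModular → IsModularGaloisRepTateAll W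

/-- S2 with compatible-system OUTPUT. -/
def SigLiftFiveCS : Prop :=
  ∀ (W : WeierstrassCurve ℚ) [W.IsElliptic] (ρ : ModPGaloisRep ℚ (ZMod 5) 2),
    W.IsTorsionGaloisRep 5 ρ → ρ.IsAbsIrreducibleOverSqrt 5 → ¬ 25 ∣ W.conductorNorm ℤ →
    ρ.IsModular → IsModularGaloisRepTateAll W

/-- **L2 (k3 gen 5, verbatim) — `SteinbergSignPacket`, the sign bit at the multiplicative places.**
For every elliptic `W/ℚ` and every newform `f₀ ∈ S₂(Γ₀(N))` at level `N = N_W` carrying `a_p(W)` for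
`p ∤ N` with `W` good off `N`: `a_p(f₀) = a_p(W)` at every prime `p ∥ N` (`-λ_p(f₀) = +1` at split,
`-1` at non-split multiplicative reduction).  Invisible to conductors, quadratic twists and the
functional equation; in print Darmon–Diamond–Taylor Thm. 3.1 (e), first case.
[cite: DarmonDiamondTaylor1995, Thm. 3.1 (e) (p. 86) and p. 87] [cite: CarayolASENS1986, Thm. (A)] -/
def SteinbergSignPacket : Prop :=
  ∀ (W : WeierstrassCurve ℚ) [W.IsElliptic] {N : ℕ} [NeZero N] (f₀ : CuspForm (Gamma0 N) 2),
    IsNewform0 f₀ → N = W.conductorNorm ℤ →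
    (∀ v : HeightOneSpectrum (𝓞 ℚ), ¬ ((primesEquiv v : ℕ) ∣ N) → W.HasGoodReductionAt v) →
    (∀ p : ℕ, p.Prime → ¬ p ∣ N → cuspCoeff f₀ p = (W.LFunction p : ℂ)) →
    ∀ p : ℕ, p.Prime → p ∣ N → ¬ p ^ 2 ∣ N → cuspCoeff f₀ p = (W.LFunction p : ℂ)

/-- **NEW (gen 6) — `Newform0SteinbergCoinvariants`, the typed residual of the Euler-factor debt.**
Carayol's local–global compatibility READ ON THE INERTIA COINVARIANTS, but ONLY for weight `2`,
trivial character (the `Γ₁(N)`-lift of a `Γ₀(N)`-newform `f₀`) and the places `ℓ ∥ N`: for every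
irreducible `p`-adic `ρ` attached to the lift away from `N p` (`p ≠ ℓ`), every prime `𝔔 ∣ ℓ` of `ℤ̄`
and every arithmetic Frobenius `σ` at `𝔔`, the reversed characteristic polynomial of `σ` on `ρ_{I_𝔔}`
is the `ℓ`-th Hecke factor `1 - a_ℓ(f₀) T + ε(ℓ) ℓ T²` (`= 1 - a_ℓ(f₀) T`, since `ε = 𝟙_N` vanishes at
`ℓ ∣ N`; `a_ℓ(f₀) = -λ_ℓ(f₀) ∈ {±1}`, Atkin–Lehner Thm. 3) — i.e. "`ρ|_{G_ℓ} ≅ (χε, *; 0, χ)`, `χ`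
unramified, `χ(Frob_ℓ) = a_ℓ`" (Darmon–Diamond–Taylor Thm. 3.1 (e), first case `ℓ ∥ N`, `ψ = 1`;
Deligne–Rapoport 1973 / Langlands 1973 (Antwerp II), before Carayol).  Binder-for-binder the instance
`k = 2`, `g = liftToGamma1 N 2 f₀`, `ℓ ∣ N`, `¬ ℓ² ∣ N` of `Carayol1986_eulerFactor`.
[cite: DarmonDiamondTaylor1995, Thm. 3.1 (e) (p. 86), p. 87 ([DR], [Ll1])]
[cite: CarayolASENS1986, Thm. (A), (0.7) with (0.5), (0.8) (pp. 410–411)]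
[cite: Rohrlich1997, §3.8 Thm. 5] [cite: AtkinLehner1970, Thm. 3] -/
def Newform0SteinbergCoinvariants : Prop :=
  ∀ {N : ℕ} [NeZero N] (f₀ : CuspForm (Gamma0 N) 2), IsNewform0 f₀ →
    ∀ (p : ℕ) [Fact p.Prime] (ι : PadicAlgCl p ≃+* ℂ) (ρ : FramedGaloisRep ℚ (PadicAlgCl p) 2),
      IsGaloisRepOfNewform1 (liftToGamma1 N 2 f₀)
        ((ι.symm : ℂ →+* PadicAlgCl p).comp (algebraMap (coeffCharField (liftToGamma1 N 2 f₀)) ℂ))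
          {q | q ∣ N * p} ρ →
      ρ.toGaloisRep.IsIrreducible →
    ∀ ℓ : ℕ, ℓ.Prime → ℓ ≠ p → ℓ ∣ N → ¬ ℓ ^ 2 ∣ N →
    ∀ w : HeightOneSpectrum (𝓞 ℚ), (ℓ : 𝓞 ℚ) ∈ w.asIdeal → ∀ 𝔔 ∈ w.primesAbove,
    ∀ σ : 𝔔.decompositionSubgroup (absoluteGaloisGroup ℚ),
      IsArithFrobAt (𝓞 ℚ) (σ : absoluteGaloisGroup ℚ) 𝔔 →
      (ρ.toGaloisRep.toInertiaCoinvariants 𝔔 σ).charpoly.reverse =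
        1 - C (ι.symm (cuspCoeff (liftToGamma1 N 2 f₀) ℓ)) * X +
          C (ι.symm ((nebentypus (liftToGamma1 N 2 f₀) (ℓ : ZMod N) : ℂ) *
            (ℓ : ℂ) ^ ((2 : ℤ) - 1))) * X ^ 2

/-- **Saito's `p = 2` leaf of Ogg's formula on the FREY FAMILY off the CM corner** (`|ab(a+b)| = 2` is
`isModular_freyCurve_of_natAbs_eq_two`, LANDED): the statement of k3 gen 3's PROVED `freySaito_forall`
(`…_3g3_Sketch.lean`, from `FreySwanThreeOfTwoMul` = the since-landed
`Summit.ABC.ABC.Theorems.swanConductorAt_torsion_three_freyCurve_of_two_mul`). A binder here only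
because crux-dir companions are not built modules. [cite: Saito1988, Theorem 1]
[cite: DiamondKramer1995, Lemma 2] -/
def FreySaitoTwo : Prop :=
  ∀ (a b : ℤ), IsCoprime a b → a * b * (a + b) ≠ 0 → (a * b * (a + b)).natAbs ≠ 2 →
    ∀ (ℓ : ℕ) [Fact ℓ.Prime],
      (freyCurve a b).swanConductorAt_rationalTate_eq_wildConductorExponent_of_ringChar_eq_two ℓ

/-! ## The strengthened lift stubs cost nothing: closed from the SAME catalogued facts -/

/-- `SigLiftThreeCS ⇐ CDT_theorem_7_2_1` (conclusion `IsModular`, then (2) ⇒ (4) at EVERY prime). -/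
theorem sigLiftThreeCS_of_CDT_theorem_7_2_1 (h : CDT_theorem_7_2_1) : SigLiftThreeCS := by
  intro W _ ρ hρ hirr h9 _ p _
  haveI : NeZero (W.conductorNorm ℤ) := ⟨(conductorNorm_pos_holds W).ne'⟩
  exact (h W ρ hρ hirr fun h27 ↦ h9 (dvd_trans ⟨3, rfl⟩ h27)).isModularGaloisRepTate p

/-- `SigLiftFiveCS ⇐ CDT_theorem_7_2_2`. -/
theorem sigLiftFiveCS_of_CDT_theorem_7_2_2 (h : CDT_theorem_7_2_2) : SigLiftFiveCS := by
  intro W _ ρ hρ hirr _ hmod p _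
  haveI : NeZero (W.conductorNorm ℤ) := ⟨(conductorNorm_pos_holds W).ne'⟩
  exact (h W ρ hρ hirr hmod).isModularGaloisRepTate p

/-- Sanity: the CS cut is WEAKER than S9. -/
theorem sigThreeImpTwoCS_of_stub (h32 : SigStubThreeImpTwo) : SigThreeImpTwoCS := by
  intro W _ _ h
  haveI : Fact (Nat.Prime 3) := ⟨Nat.prime_three⟩
  exact h32 W 3 (h 3)

/-- Sanity: the Frey CS cut is WEAKER than the ∀W CS cut. -/
theorem sigThreeImpTwoFreyCS_of_CS (h : SigThreeImpTwoCS) : SigThreeImpTwoFreyCS :=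
  fun a b _ _ _ _ hall ↦ h (freyCurve a b) hall

/-! ## The residual is an INSTANCE of `Carayol1986_eulerFactor` (one line) -/

/-- `Newform0SteinbergCoinvariants ⇐ Carayol1986_eulerFactor`: instantiate `k := 2`,
`g := liftToGamma1 N 2 f₀` (a `Γ₁(N)`-newform by `isNewform1_liftToGamma1_iff_holds`) and forget the
two divisibility hypotheses. [cite: CarayolASENS1986, Thm. (A)] -/
theorem newform0SteinbergCoinvariants_of_carayol1986_eulerFactor (h : Carayol1986_eulerFactor) :
    Newform0SteinbergCoinvariants := by
  intro N _ f₀ hf₀ p _ ι ρ hρ hirr ℓ hℓ hne _ _ w hw 𝔔 h𝔔 σ hσ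
  exact h (liftToGamma1 N 2 f₀) le_rfl ((isNewform1_liftToGamma1_iff_holds N 2 f₀).mpr hf₀) p ι ρ hρ
    hirr ℓ hℓ hne w hw 𝔔 h𝔔 σ hσ

/-! ## Ported PROVED blocks of k2 gen 5 (M0, M1, packet port, M2, H4) — verbatim -/

/-- The `X`-coefficient of `X² - a X + b` is `-a` (ideator-1's helper, verbatim). [folklore] -/
theorem coeff_one_X_sq_sub_C_mul_X_add_C' {S : Type*} [CommRing S] (a b : S) :
    (Polynomial.X ^ 2 - Polynomial.C a * Polynomial.X + Polynomial.C b).coeff 1 = -a := by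
  simp [Polynomial.coeff_X_pow, Polynomial.coeff_C]

/-- **M0 (descent KEEPING the inertia clause; ideator-1's H1, ported verbatim — PROVED).**
`ρ_{E,ℓ}` modular ⇒ a newform `f₀ ∈ S₂(Γ₀(N))` with `E` good off `N ℓ` (Néron–Ogg–Shafarevich on the
inertia clause of `IsModularGaloisRepTate`) and `a_p(f₀) = a_p(E)` for `p ∤ N ℓ` (the `X`-coefficient
of the Frobenius polynomial); the tree's `exists_rational_isNewform0_of_isModularGaloisRepTate'`
forgets the good reduction, which the merge below needs. -/
theorem exists_isNewform0_hasGoodReductionAt_of_isModularGaloisRepTate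
    (W : WeierstrassCurve ℚ) [W.IsElliptic] (ℓ : ℕ) [Fact ℓ.Prime] (h : W.IsModularGaloisRepTate ℓ) :
    ∃ (N : ℕ) (_ : NeZero N) (f₀ : CuspForm (Gamma0 N) 2), IsNewform0 f₀ ∧
      (∀ v : HeightOneSpectrum (𝓞 ℚ), ¬ ((primesEquiv v : ℕ) ∣ N * ℓ) → W.HasGoodReductionAt v) ∧
      ∀ p : ℕ, p.Prime → ¬ p ∣ N * ℓ → cuspCoeff f₀ p = (W.LFunction p : ℂ) := by
  classical
  have hℓp : ℓ.Prime := Fact.out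
  obtain ⟨N, hN, f, K, hK, hA, ι, hnew, hε, hcl⟩ := (isModularGaloisRepTate_iff_weight_two W ℓ).mp h
  -- descent to `Γ₀(N)`
  have hdia : ∀ d : ZMod N, IsUnit d → diamondOp N 2 d f = f := by
    intro d hd
    obtain ⟨u, rfl⟩ := hd
    rw [hnew.diamondOp_apply_eq_nebentypus_smul u, hε, MulChar.one_apply_coe, one_smul]
  obtain ⟨f₀, hf₀⟩ := exists_liftToGamma1_eq_of_forall_diamondOp_eq 2 f hdia
  have hnew₀ : IsNewform0 f₀ := (isNewform1_liftToGamma1_iff_holds N 2 f₀).mp (hf₀ ▸ hnew)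
  have hcoe : (⇑f₀ : UpperHalfPlane → ℂ) = ⇑f := by rw [← hf₀, coe_liftToGamma1_holds]
  -- good reduction off `N ℓ`: Néron–Ogg–Shafarevich
  have hgood : ∀ v : HeightOneSpectrum (𝓞 ℚ), ¬ ((primesEquiv v : ℕ) ∣ N * ℓ) →
      W.HasGoodReductionAt v := by
    intro v hv
    have hpℓ : (primesEquiv v : ℕ) ≠ ℓ := fun h' ↦ hv (by rw [← h']; exact dvd_mul_left _ _)
    have hℓv : ((ℓ : ℕ) : 𝓞 ℚ) ∉ v.asIdeal := by
      rw [Literature.NumberTheory.GaloisRepresentations.Rat.natCast_mem_asIdeal_iff]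
      exact fun h' ↦ hpℓ ((Nat.prime_dvd_prime_iff_eq (primesEquiv v).2 hℓp).mp h')
    exact W.neronOggShafarevich_holds v ℓ hℓv fun 𝔓 h𝔓 τ hτ ↦ (hcl v hv 𝔓 h𝔓).1 τ hτ
  refine ⟨N, hN, f₀, hnew₀, hgood, fun p hp hpNℓ ↦ ?_⟩
  -- the place `v` of `ℚ` at `p`, a prime of `ℤ̄` above it and an arithmetic Frobenius
  obtain ⟨v, rfl⟩ : ∃ v : HeightOneSpectrum (𝓞 ℚ), (primesEquiv v : ℕ) = p :=
    ⟨primesEquiv.symm ⟨p, hp⟩, by rw [Equiv.apply_symm_apply]⟩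
  obtain ⟨𝔓, h𝔓⟩ := primesAbove_nonempty v
  obtain ⟨σ, hσ⟩ := exists_isArithFrobAt_of_mem_primesAbove_holds (v := v) h𝔓
  have hpℓ : (primesEquiv v : ℕ) ≠ ℓ := fun h' ↦ hpNℓ (by rw [← h']; exact dvd_mul_left _ _)
  have hgoodv : W.HasGoodReductionAt v := hgood v hpNℓ
  have hℓv : ((ℓ : ℕ) : 𝓞 ℚ) ∉ v.asIdeal := by
    rw [Literature.NumberTheory.GaloisRepresentations.Rat.natCast_mem_asIdeal_iff]
    exact fun h' ↦ hpℓ ((Nat.prime_dvd_prime_iff_eq hp hℓp).mp h')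
  have htr := W.trace_galoisRepTate_frobenius_of_hasGoodReductionAt_holds ℓ v hℓv hgoodv h𝔓 hσ
  -- compare the `X`-coefficients of the two characteristic polynomials
  have h1 := congrArg (fun P : Polynomial K ↦ P.coeff 1) ((hcl v hpNℓ 𝔓 h𝔓).2 σ hσ)
  rw [Polynomial.coeff_map, Polynomial.coeff_map, coeff_one_X_sq_sub_C_mul_X_add_C',
    Literature.NumberTheory.EllipticCurves.ModularForms.heckePolynomial,
    coeff_one_X_sq_sub_C_mul_X_add_C', map_neg, map_neg, neg_inj, htr, map_intCast,
    ← map_intCast ι] at h1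
  have h2 := congrArg Subtype.val (ι.injective h1)
  change (((W.frobeniusTraceAt v : ℤ) : coeffCharField f) : ℂ) =
    (UpperHalfPlane.qExpansion 1 ⇑f).coeff (primesEquiv v : ℕ) at h2
  rw [cuspCoeff, hcoe, W.lFunction_primesEquiv_eq_frobeniusTraceAt hgoodv, ← h2]
  norm_cast

/-- **M1 (NEW; strong multiplicity one across levels, coefficient form; S ≈ 25 lines — PROVED here).**
Two `Γ₀` newforms of weight `2` whose prime coefficients agree off a finite modulus have the same
level and the same `q`-expansion. -/
theorem level_eq_and_cuspCoeff_eq_of_cuspCoeff_eq_off {N₁ N₂ : ℕ} [NeZero N₁] [NeZero N₂]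
    {f₁ : CuspForm (Gamma0 N₁) 2} {f₂ : CuspForm (Gamma0 N₂) 2} (hf₁ : IsNewform0 f₁)
    (hf₂ : IsNewform0 f₂) {M : ℕ} (hM : M ≠ 0)
    (h : ∀ p : ℕ, p.Prime → ¬ p ∣ M → cuspCoeff f₁ p = cuspCoeff f₂ p) :
    ∃ e : N₁ = N₂, ∀ n : ℕ, cuspCoeff f₁ n = cuspCoeff (e ▸ f₂) n := by
  have hfin : {p : ℕ | p.Prime ∧ heckeEigenvalue f₁ p ≠ heckeEigenvalue f₂ p}.Finite := by
    refine M.primeFactors.finite_toSet.subset ?_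
    rintro p ⟨hp, hne⟩
    refine (Nat.mem_primeFactors_of_ne_zero hM).mpr ⟨hp, ?_⟩
    by_contra hpM
    apply hne
    rw [heckeEigenvalue_eq_coeff_of_isNormalized hf₁.2.2 hp (hf₁.2.1 p hp),
      heckeEigenvalue_eq_coeff_of_isNormalized hf₂.2.2 hp (hf₂.2.1 p hp)]
    exact h p hp hpM
  have hN : N₁ = N₂ := IsNewform0.level_eq_of_heckeEigenvalue_eq_holds hf₁ hf₂ hfin
  subst hN
  refine ⟨rfl, fun n ↦ ?_⟩
  rw [IsNewform0.eq_of_heckeEigenvalue_eq_holds hf₁ hf₂ hfin]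


section PacketPort
open UpperHalfPlane

/-- A `Γ₀(M)`-newform is non-zero (`a₁ = 1`) — verbatim copy of the tree's
`IsNewform0.ne_zero_of_isNormalized` (`BCDTModularityTwistProofs`, unbuilt on the snapshot). [folklore] -/
theorem isNewform0_ne_zero_of_isNormalized {M : ℕ} [NeZero M] {k : ℤ} {g : CuspForm (Gamma0 M) k}
    (hg : IsNewform0 g) : g ≠ 0 := by
  intro h
  have h1 : cuspCoeff g 1 = 1 := hg.2.2
  rw [h, cuspCoeff_zero_form (one_mem_strictPeriods_gamma0 M)] at h1
  exact zero_ne_one h1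

/-- **An integral newform packet makes `ρ̄` modular** — VERBATIM copy of the tree's
`Literature.NumberTheory.Automorphic.BCDT.isModular_of_isNewform0_packet`
(`BCDTModularityTwistProofs`, l. 134), inlined only because that module is unbuilt on the current
farm snapshot (`remote:stale:…:unbuilt`); a prover cites the tree decl instead.
[cite: BCDTJAMS2001, Introduction ("ρ̄ is modular")] [cite: DiamondShurman2005, Def. 9.6.4] -/
theorem isModular_of_isNewform0_packet' {M : ℕ} [NeZero M] {g : CuspForm (Gamma0 M) 2}
    (hg : IsNewform0 g) {ℓ : ℕ} [Fact ℓ.Prime] {b : ℕ → ℤ}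
    (hb : ∀ p : ℕ, p.Prime → ¬ p ∣ M * ℓ → cuspCoeff g p = (b p : ℂ))
    {ρ : ModPGaloisRep ℚ (ZMod ℓ) 2}
    (hρ : ∀ v : HeightOneSpectrum (𝓞 ℚ), ¬ ((primesEquiv v : ℕ) ∣ M * ℓ) →
      ρ.IsUnramifiedAt v ∧ ρ.HasFrobCharpolyAt v
        (X ^ 2 - C ((b (primesEquiv v : ℕ) : ℤ) : ZMod ℓ) * X + C ((primesEquiv v : ℕ) : ZMod ℓ))) :
    ρ.IsModular := by
  classical
  have hℓp : ℓ.Prime := Fact.out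
  have hgne : g ≠ 0 := isNewform0_ne_zero_of_isNormalized hg
  -- the newform on `Γ₁(M)` with trivial character
  set f₁ : CuspForm (Gamma1 M) 2 := liftToGamma1 M 2 g with hf₁
  have hnew : IsNewform1 f₁ := (isNewform1_liftToGamma1_iff_holds M 2 g).mpr hg
  have hcoe : (⇑f₁ : ℍ → ℂ) = ⇑g := coe_liftToGamma1_holds _ 2 g
  have hε : nebentypus f₁ = 1 := nebentypus_liftToGamma1_holds _ 2 hgne
  -- a prime `𝔪` of the coefficient ring `𝓞_f` above `ℓ`, and `K = 𝓞_f / 𝔪 ⊇ 𝔽_ℓ`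
  haveI : Algebra.IsIntegral ℤ (coeffCharIntegers f₁) := by
    unfold coeffCharIntegers; infer_instance
  haveI hmax : (Ideal.span {(ℓ : ℤ)}).IsMaximal :=
    PrincipalIdealRing.isMaximal_of_irreducible (Nat.prime_iff_prime_int.mp hℓp).irreducible
  obtain ⟨𝔪, h𝔪max, h𝔪⟩ := Ideal.exists_ideal_over_maximal_of_isIntegral
    (S := coeffCharIntegers f₁) (Ideal.span {(ℓ : ℤ)}) (fun x hx ↦ by
      rw [RingHom.mem_ker, eq_intCast, Int.cast_eq_zero] at hx
      rw [hx]; exact Ideal.zero_mem _)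
  haveI : 𝔪.IsMaximal := h𝔪max
  have hℓ𝔪 : ((ℓ : ℕ) : coeffCharIntegers f₁) ∈ 𝔪 := by
    have h : ((ℓ : ℕ) : ℤ) ∈ 𝔪.comap (algebraMap ℤ (coeffCharIntegers f₁)) := by
      rw [h𝔪]; exact Ideal.mem_span_singleton_self _
    rwa [Ideal.mem_comap, map_natCast] at h
  let K : Type := coeffCharIntegers f₁ ⧸ 𝔪
  letI : Field K := Ideal.Quotient.field 𝔪
  letI : TopologicalSpace K := ⊥
  haveI : DiscreteTopology K := ⟨rfl⟩
  have hℓK : ((ℓ : ℕ) : K) = 0 := by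
    rw [← map_natCast (Ideal.Quotient.mk 𝔪), Ideal.Quotient.eq_zero_iff_mem]
    exact hℓ𝔪
  haveI : CharP K ℓ := (CharP.charP_iff_prime_eq_zero hℓp).mpr hℓK
  let j : ZMod ℓ →+* K := ZMod.castHom (dvd_refl ℓ) K
  let ι : coeffCharIntegers f₁ →+* K := Ideal.Quotient.mk 𝔪
  refine ⟨M, inferInstance, 2, f₁, K, inferInstance, inferInstance, inferInstance, j, ι, by norm_num,
    hnew, ?_⟩
  -- `ρ̄ ⊗ K` is attached to `f₁` away from `M ℓ`
  intro v hv
  have hpp : (primesEquiv v : ℕ).Prime := (primesEquiv v).2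
  rw [ZMod.ringChar_zmod_n] at hv
  have hv' : ¬ ((primesEquiv v : ℕ) ∣ M * ℓ) := hv
  have hpM : ¬ (primesEquiv v : ℕ) ∣ M := fun h ↦ hv' (dvd_mul_of_dvd_left h _)
  obtain ⟨hunr, hfrob⟩ := hρ v hv'
  refine ⟨?_, ?_⟩
  · -- unramified at `p`
    intro 𝔓 h𝔓 τ hτ
    rw [FramedRep.baseChange_apply, hunr 𝔓 h𝔓 τ hτ, map_one]
  · -- the Hecke polynomial `X² - b_p X + p`, integrally, and the Frobenius characteristic polynomial
    have hap : (qExpansion 1 ⇑f₁).coeff (primesEquiv v : ℕ) = ((b (primesEquiv v : ℕ) : ℤ) : ℂ) := by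
      rw [hcoe]; exact hb _ hpp hv'
    have hεp : (nebentypus f₁ ((primesEquiv v : ℕ) : ZMod M) : ℂ) *
        ((primesEquiv v : ℕ) : ℂ) ^ ((2 : ℤ) - 1) = ((primesEquiv v : ℕ) : ℂ) := by
      rw [hε, MulChar.one_apply ((ZMod.isUnit_prime_iff_not_dvd hpp).mpr hpM), one_mul]
      norm_num
    have h1 : (⟨(qExpansion 1 ⇑f₁).coeff (primesEquiv v : ℕ),
        cuspCoeff_mem_coeffCharField f₁ (primesEquiv v : ℕ)⟩ : coeffCharField f₁) =
        ((b (primesEquiv v : ℕ) : ℤ) : coeffCharField f₁) :=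
      Subtype.ext (by
        change PowerSeries.coeff _ (qExpansion 1 ⇑f₁) = _
        rw [hap]; norm_cast)
    have h2 : (⟨(nebentypus f₁ ((primesEquiv v : ℕ) : ZMod M) : ℂ) *
        ((primesEquiv v : ℕ) : ℂ) ^ ((2 : ℤ) - 1),
        nebentypus_mul_zpow_mem_coeffCharField f₁ (primesEquiv v : ℕ)⟩ : coeffCharField f₁) =
        ((primesEquiv v : ℕ) : coeffCharField f₁) :=
      Subtype.ext (by
        change (nebentypus f₁ ((primesEquiv v : ℕ) : ZMod M) : ℂ) *
          ((primesEquiv v : ℕ) : ℂ) ^ ((2 : ℤ) - 1) = _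
        rw [hεp]; norm_cast)
    refine ⟨X ^ 2 - C ((b (primesEquiv v : ℕ) : ℤ) : coeffCharIntegers f₁) * X +
      C ((primesEquiv v : ℕ) : coeffCharIntegers f₁), ?_, ?_⟩
    · rw [Polynomial.map_add, Polynomial.map_sub, Polynomial.map_mul, Polynomial.map_pow,
        Polynomial.map_X, Polynomial.map_C, Polynomial.map_C, map_intCast, map_natCast,
        Literature.NumberTheory.EllipticCurves.ModularForms.heckePolynomial, h1, h2]
    · intro 𝔓 h𝔓 σ hσ
      have hch := hfrob 𝔓 h𝔓 σ hσ
      have hmap : (Units.val (Matrix.GeneralLinearGroup.map j (ρ σ)) : Matrix (Fin 2) (Fin 2) K) =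
          ((ρ σ : GL (Fin 2) (ZMod ℓ)) : Matrix (Fin 2) (Fin 2) (ZMod ℓ)).map j := rfl
      simp only [FramedRep.charpoly, FramedRep.baseChange_apply] at hch ⊢
      rw [hmap, Matrix.charpoly_map, hch]
      simp only [Polynomial.map_add, Polynomial.map_sub, Polynomial.map_mul, Polynomial.map_pow,
        Polynomial.map_X, Polynomial.map_C]
      rw [map_intCast j, map_natCast j, map_intCast ι, map_natCast ι]

end PacketPort

/-- **M2 (= gen-3 H1; UNCONDITIONAL — PROVED).**  `ρ_{E,ℓ}` modular ⇒ every framed model of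
`E[ℓ]` is modular — SAME prime, so no `ℓ`-hole: the packet of `IsModularGaloisRepTate ℓ` is off `N ℓ`,
exactly the exceptional set of `ModPGaloisRep.IsModular`.  M0 feeds the tree's
`isModular_of_isNewform0_packet` with `b p := a_p(E)`; the curve side (unramified + Frobenius polynomial
mod `ℓ` at the good places off `N ℓ`) is the body of `IsModular.exists_isNewform0_packet` with the
conductor replaced by `N`.  Generalises `IsModular.isModular_of_isTorsionGaloisRep''`
(`BCDT.IsModular W` weakened to `W.IsModularGaloisRepTate ℓ`). -/
theorem isModular_torsion_of_isModularGaloisRepTate_self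
    (W : WeierstrassCurve ℚ) [W.IsElliptic] (ℓ : ℕ) [Fact ℓ.Prime] (h : W.IsModularGaloisRepTate ℓ)
    {ρ : ModPGaloisRep ℚ (ZMod ℓ) 2} (hρ : W.IsTorsionGaloisRep ℓ ρ) : ρ.IsModular := by
  have hℓp : ℓ.Prime := Fact.out
  obtain ⟨N, hN, f₀, hf₀, hgoodN, hap⟩ :=
    exists_isNewform0_hasGoodReductionAt_of_isModularGaloisRepTate W ℓ h
  have htr := W.trace_galoisRepTate_frobenius_of_hasGoodReductionAt_holds ℓ
  have hdet : W.det_galoisRepTate_frobenius_of_hasGoodReductionAt ℓ :=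
    det_galoisRepTate_frobenius_of_hasGoodReductionAt_of_exists_weilPairing
      fun _ ↦ W.exists_weilPairing_holds _
  refine isModular_of_isNewform0_packet' hf₀ (b := fun p ↦ W.LFunction p)
    (fun p hp hpN ↦ hap p hp hpN) fun v hv ↦ ?_
  have hpp : (primesEquiv v : ℕ).Prime := (primesEquiv v).2
  have hpℓ : (primesEquiv v : ℕ) ≠ ℓ := fun h' ↦ hv (by rw [← h']; exact dvd_mul_left _ _)
  have hgood : W.HasGoodReductionAt v := hgoodN v hv
  have hℓv : ((ℓ : ℕ) : 𝓞 ℚ) ∉ v.asIdeal := by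
    rw [Literature.NumberTheory.GaloisRepresentations.Rat.natCast_mem_asIdeal_iff]
    exact fun h' ↦ hpℓ ((Nat.prime_dvd_prime_iff_eq hpp hℓp).mp h')
  refine ⟨hρ.isUnramifiedAt_of_hasGoodReductionAt hgood hℓv, ?_⟩
  intro 𝔓 h𝔓 σ hσ
  have hch := hρ.charpoly_eq_of_isArithFrobAt htr hdet hℓv hgood h𝔓 hσ
  rw [natCard_residueField_adicCompletionIntegers,
    ← W.lFunction_primesEquiv_eq_frobeniusTraceAt hgood] at hch
  exact hch

/-- The `X`-coefficient of `1 - a X + b X²` is `-a`. [folklore] -/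
theorem coeff_quad_one {S : Type*} [CommRing S] (a b : S) :
    (1 - C a * X + C b * X ^ 2 : S[X]).coeff 1 = -a := by
  simp [Polynomial.coeff_one, Polynomial.coeff_X_pow, Polynomial.coeff_C, Polynomial.coeff_X]

/-- The `X²`-coefficient of `1 - a X + b X²` is `b`. [folklore] -/
theorem coeff_quad_two {S : Type*} [CommRing S] (a b : S) :
    (1 - C a * X + C b * X ^ 2 : S[X]).coeff 2 = b := by
  simp [Polynomial.coeff_one, Polynomial.coeff_X_pow, Polynomial.coeff_C, Polynomial.coeff_X]

/-- **H4 (read off both coefficients).**  From the local identity of H3 at `v`: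
`a_q(f₀) = a_q(E)` (the `T`-coefficient of `L_v(E,T)` is `-a_q(E)` for every reduction type:
`localPolynomialAt_of_hasGoodReductionAt` / `…SplitMultiplicative…` / `…not_hasSplit…` /
`…Additive…` with `LFunction_apply_primesEquiv_of_has…ReductionAt`) and `q ∣ N ↔ q ∣ N_E` (the
`T²`-coefficient is `q` iff good reduction iff `q ∤ N_E` (`dvd_conductorNorm_iff`), and
`ε(q) q = q` iff `q ∤ N`, else `0`, by `nebentypus_liftToGamma1_holds`). -/
theorem H4_cuspCoeff_eq_and_dvd_iff (W : WeierstrassCurve ℚ) [W.IsElliptic] {N : ℕ} [NeZero N]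
    (f₀ : CuspForm (Gamma0 N) 2) (hf₀ : IsNewform0 f₀) (v : HeightOneSpectrum (𝓞 ℚ))
    (hloc : (W.localPolynomialAt v).map (Int.castRingHom ℂ) =
      1 - C (cuspCoeff f₀ (primesEquiv v : ℕ)) * X +
        C ((nebentypus (liftToGamma1 N 2 f₀) ((primesEquiv v : ℕ) : ZMod N) : ℂ) *
          ((primesEquiv v : ℕ) : ℂ)) * X ^ 2) :
    cuspCoeff f₀ (primesEquiv v : ℕ) = (W.LFunction (primesEquiv v : ℕ) : ℂ) ∧
      ((primesEquiv v : ℕ) ∣ N ↔ (primesEquiv v : ℕ) ∣ W.conductorNorm ℤ) := by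
  classical
  have hqp : (primesEquiv v : ℕ).Prime := (primesEquiv v).2
  have hqC : ((primesEquiv v : ℕ) : ℂ) ≠ 0 := Nat.cast_ne_zero.mpr hqp.ne_zero
  have hf0 : f₀ ≠ 0 := IsNormalized.ne_zero hf₀.2.2
  -- the value `ε(q)` of the (trivial mod `N`) nebentypus of the lift
  have hε0 : (primesEquiv v : ℕ) ∣ N →
      nebentypus (liftToGamma1 N 2 f₀) ((primesEquiv v : ℕ) : ZMod N) = 0 := fun hqN ↦ by
    rw [nebentypus_liftToGamma1_holds (N := N) (k := 2) hf0]
    exact MulChar.map_nonunit _ (by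
      rwa [ZMod.isUnit_iff_coprime, hqp.coprime_iff_not_dvd, not_not])
  have hε1 : ¬ (primesEquiv v : ℕ) ∣ N →
      nebentypus (liftToGamma1 N 2 f₀) ((primesEquiv v : ℕ) : ZMod N) = 1 := fun hqN ↦ by
    rw [nebentypus_liftToGamma1_holds (N := N) (k := 2) hf0]
    exact MulChar.one_apply ((ZMod.isUnit_iff_coprime _ N).mpr (hqp.coprime_iff_not_dvd.mpr hqN))
  -- the two coefficients of the identity `hloc`
  have h1 := congrArg (fun P : ℂ[X] ↦ P.coeff 1) hloc
  have h2 := congrArg (fun P : ℂ[X] ↦ P.coeff 2) hloc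
  simp only [Polynomial.coeff_map, eq_intCast, coeff_quad_one, coeff_quad_two] at h1 h2
  rw [W.dvd_conductorNorm_iff v]
  obtain hG | hM | hA :=
    hasGoodReductionAt_or_hasMultiplicativeReductionAt_or_hasAdditiveReductionAt (W := W) (v := v)
  · -- good reduction: `L_v = 1 - a_v X + q X²`
    rw [localPolynomialAt_of_hasGoodReductionAt hG] at h1 h2
    rw [coeff_quad_one] at h1
    rw [coeff_quad_two, natCard_residueField_eq_residueCard] at h2
    refine ⟨?_, ?_⟩
    · rw [W.lFunction_primesEquiv_eq_frobeniusTraceAt hG]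
      -- h1 : ((-t : ℤ) : ℂ) = - a
      push_cast at h1
      first | linear_combination h1 | linear_combination -h1
    · refine iff_of_false (fun hqN ↦ ?_) (not_not.mpr hG)
      rw [hε0 hqN, zero_mul] at h2
      have h1lt := one_lt_residueCard v
      have : (v.residueCard : ℂ) = 0 := by exact_mod_cast h2
      exact absurd (by exact_mod_cast this : v.residueCard = 0) (by omega)
  · -- multiplicative reduction: `L_v = 1 ∓ X`
    have hbad : ¬ W.HasGoodReductionAt v := hM.not_hasGoodReductionAt
    by_cases hs : W.HasSplitMultiplicativeReductionAt v
    · rw [localPolynomialAt_of_hasSplitMultiplicativeReductionAt hs] at h1 h2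
      simp only [coeff_sub, coeff_one, coeff_X, if_neg (one_ne_zero), if_pos rfl] at h1
      simp only [coeff_sub, coeff_one, coeff_X] at h2
      norm_num at h1 h2
      refine ⟨?_, iff_of_true ?_ hbad⟩
      · rw [W.LFunction_apply_primesEquiv_of_hasSplitMultiplicativeReductionAt hs]
        push_cast
        first | linear_combination h1 | linear_combination -h1
      · by_contra hqN
        exact one_ne_zero ((hε1 hqN).symm.trans (h2.resolve_right (by exact_mod_cast hqp.ne_zero)))
    · rw [localPolynomialAt_of_hasMultiplicativeReductionAt_of_not_hasSplitMultiplicativeReductionAt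
        hM hs] at h1 h2
      simp only [coeff_add, coeff_one, coeff_X] at h1 h2
      norm_num at h1 h2
      refine ⟨?_, iff_of_true ?_ hbad⟩
      · rw [W.LFunction_apply_primesEquiv_of_hasMultiplicativeReductionAt_of_not_split hM hs]
        push_cast
        first | linear_combination h1 | linear_combination -h1
      · by_contra hqN
        exact one_ne_zero ((hε1 hqN).symm.trans (h2.resolve_right (by exact_mod_cast hqp.ne_zero)))
  · -- additive reduction: `L_v = 1`
    have hbad : ¬ W.HasGoodReductionAt v := hA.not_hasGoodReductionAt
    rw [localPolynomialAt_of_hasAdditiveReductionAt hA] at h1 h2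
    simp only [coeff_one] at h1 h2
    norm_num at h1 h2
    refine ⟨?_, iff_of_true ?_ hbad⟩
    · rw [W.LFunction_apply_primesEquiv_of_hasAdditiveReductionAt hA]
      push_cast
      first | linear_combination h1 | linear_combination -h1
    · by_contra hqN
      exact one_ne_zero ((hε1 hqN).symm.trans (h2.resolve_right (by exact_mod_cast hqp.ne_zero)))

/-! ## NEW (gen 6): the sign bit from the restricted residual — PROVED -/

/-- **R (realisation; k2 gen 5 B1 with the auxiliary prime as INPUT).**  For the a.e. packet
(`f₀ ∈ S₂(Γ₀(N))` newform, `W` good off `N`, `a_q(f₀) = a_q(W)` for `q ∤ N`) and a prime `p` with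
`V_p W` irreducible: a framed model `VQ ≅ V_p W` whose base change `VQ ⊗ ℚ̄_p` is attached to the
`Γ₁(N)`-lift of `f₀` away from `N p` and is irreducible (odd + irreducible ⇒ absolutely irreducible).
PROVED (B1's body). [cite: DarmonDiamondTaylor1995, Thm. 3.1 (b), (c)] -/
theorem realisation_baseChange_rationalTate_of_packet (W : WeierstrassCurve ℚ) [W.IsElliptic]
    {N : ℕ} [NeZero N] (f₀ : CuspForm (Gamma0 N) 2) (hf₀ : IsNewform0 f₀)
    (hgood : ∀ v : HeightOneSpectrum (𝓞 ℚ), ¬ ((primesEquiv v : ℕ) ∣ N) → W.HasGoodReductionAt v)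
    (hap : ∀ p : ℕ, p.Prime → ¬ p ∣ N → cuspCoeff f₀ p = (W.LFunction p : ℂ))
    (p : ℕ) [hpF : Fact p.Prime] (ι : PadicAlgCl p ≃+* ℂ)
    (hirrW : (W.rationalGaloisRepTate p).IsIrreducible) :
    ∃ (VQ : FramedGaloisRep ℚ ℚ_[p] 2) (eV : (Fin 2 → ℚ_[p]) ≃ₗ[ℚ_[p]] W.rationalTateModule p),
      (∀ (σ : absoluteGaloisGroup ℚ) (x : Fin 2 → ℚ_[p]),
        eV (FramedRep.toRepresentation VQ σ x) = W.rationalGaloisRepTate p σ (eV x)) ∧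
      IsGaloisRepOfNewform1 (liftToGamma1 N 2 f₀)
        ((ι.symm : ℂ →+* PadicAlgCl p).comp (algebraMap (coeffCharField (liftToGamma1 N 2 f₀)) ℂ))
        {q | q ∣ N * p}
        (VQ.baseChange (algebraMap ℚ_[p] (PadicAlgCl p)) (continuous_algebraMap_padicAlgCl p)) ∧
      (FramedGaloisRep.toGaloisRep (VQ.baseChange (algebraMap ℚ_[p] (PadicAlgCl p))
        (continuous_algebraMap_padicAlgCl p))).IsIrreducible := by
  classical
  have hp : p.Prime := hpF.out
  obtain ⟨VQ, eV, heV, hV⟩ := exists_framedGaloisRep_rationalTate W p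
  have hf0 : f₀ ≠ 0 := IsNormalized.ne_zero hf₀.2.2
  refine ⟨VQ, eV, heV, fun v hv ↦ ?_, ?_⟩
  · -- attached to the lift of `f₀` off `N p`
    have hq : (primesEquiv v : ℕ).Prime := (primesEquiv v).2
    have hqNp : ¬ (primesEquiv v : ℕ) ∣ N * p := hv
    have hqN : ¬ (primesEquiv v : ℕ) ∣ N := fun h ↦ hqNp (dvd_mul_of_dvd_left h _)
    have hqp : (primesEquiv v : ℕ) ≠ p := fun h ↦ hqNp (h ▸ dvd_mul_left p N)
    have hpv : (p : 𝓞 ℚ) ∉ v.asIdeal := natCast_not_mem_asIdeal_of_primesEquiv_ne hp hqp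
    obtain ⟨hur, hchar⟩ := hV v hpv (hgood v hqN)
    refine ⟨(FramedGaloisRep.isUnramifiedAt_baseChange_iff _ _
      (algebraMap ℚ_[p] (PadicAlgCl p)).injective v VQ).mpr hur, ?_⟩
    have H := FramedGaloisRep.hasFrobCharpolyAt_baseChange (algebraMap ℚ_[p] (PadicAlgCl p))
      (continuous_algebraMap_padicAlgCl p) hchar
    have hcoeff : (UpperHalfPlane.qExpansion 1 ⇑(liftToGamma1 N 2 f₀)).coeff (primesEquiv v : ℕ) =
        ((W.LFunction (primesEquiv v : ℕ) : ℤ) : ℂ) := by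
      rw [← hap _ hq hqN, cuspCoeff, coe_liftToGamma1_holds N 2 f₀]
    have hε : nebentypus (liftToGamma1 N 2 f₀) ((primesEquiv v : ℕ) : ZMod N) = 1 := by
      rw [nebentypus_liftToGamma1_holds (N := N) (k := 2) hf0]
      exact MulChar.one_apply
        ((ZMod.isUnit_iff_coprime _ N).mpr (hq.coprime_iff_not_dvd.mpr hqN))
    have h21 : ((2 : ℤ) - 1) = 1 := by norm_num
    have hpoly : (heckePolynomial (liftToGamma1 N 2 f₀) (primesEquiv v : Nat.Primes)).map
        ((ι.symm : ℂ →+* PadicAlgCl p).comp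
          (algebraMap (coeffCharField (liftToGamma1 N 2 f₀)) ℂ)) =
        (X ^ 2 - C ((W.LFunction (primesEquiv v : ℕ) : ℤ) : ℚ_[p]) * X +
          C ((primesEquiv v : ℕ) : ℚ_[p])).map (algebraMap ℚ_[p] (PadicAlgCl p)) := by
      rw [← Polynomial.map_map, map_heckePolynomial, hcoeff, hε, one_mul, h21, zpow_one]
      simp only [Polynomial.map_add, Polynomial.map_sub, Polynomial.map_mul, Polynomial.map_pow,
        Polynomial.map_X, map_intCast, map_natCast, Polynomial.map_intCast, Polynomial.map_natCast]
    rw [hpoly]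
    exact H
  · -- irreducible over `ℚ̄_p`: `V_p(E)` is irreducible (choice of `p`) and odd (Weil pairing)
    obtain ⟨c, hc⟩ := exists_isComplexConjugation (Rat.castHom ℝ)
    have hcc : c * c = 1 := by rw [← pow_two]; exact hc.sq_eq_one
    have hirrVQ : FramedRep.IsIrreducible VQ :=
      (Representation.isIrreducible_iff_of_equivariant (FramedRep.toRepresentation VQ)
        (W.rationalGaloisRepTate p) (MonoidHom.id _) Function.surjective_id eV
        (fun g x ↦ by rw [MonoidHom.id_apply]; exact heV g x)).mpr hirrW
    have hconj : FramedRep.toRepresentation VQ c =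
        (eV.symm : W.rationalTateModule p →ₗ[ℚ_[p]] (Fin 2 → ℚ_[p])) ∘ₗ
          (W.rationalGaloisRepTate p c : W.rationalTateModule p →ₗ[ℚ_[p]] W.rationalTateModule p) ∘ₗ
            (eV : (Fin 2 → ℚ_[p]) →ₗ[ℚ_[p]] W.rationalTateModule p) := by
      refine LinearMap.ext fun x ↦ ?_
      simp only [LinearMap.coe_comp, Function.comp_apply, LinearEquiv.coe_coe]
      rw [LinearEquiv.eq_symm_apply, heV]
    have h1 : LinearMap.det (FramedRep.toRepresentation VQ c) = -1 := by
      rw [hconj]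
      have h := LinearMap.det_conj
        (W.rationalGaloisRepTate p c : W.rationalTateModule p →ₗ[ℚ_[p]] W.rationalTateModule p) eV.symm
      rw [LinearEquiv.symm_symm] at h
      rw [h]
      exact Literature.AlgebraicGeometry.Motives.det_rationalGaloisRepTate_of_isComplexConjugation W p hc
    have h2 : FramedRep.toRepresentation VQ c =
        Matrix.toLin' ((VQ c : GL (Fin 2) ℚ_[p]) : Matrix (Fin 2) (Fin 2) ℚ_[p]) :=
      LinearMap.ext fun x ↦ by rw [FramedRep.toRepresentation_apply_apply, Matrix.toLin'_apply]
    have hdet : Matrix.GeneralLinearGroup.det (VQ c) = -1 := by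
      ext
      rw [Matrix.GeneralLinearGroup.val_det_apply, Units.val_neg, Units.val_one,
        ← LinearMap.det_toLin', ← h2, h1]
    have habs := FramedRep.isAbsolutelyIrreducible_of_isIrreducible_of_det_eq_neg_one VQ hirrVQ
      two_ne_zero hcc hdet
    exact habs (PadicAlgCl p) (algebraMap ℚ_[p] (PadicAlgCl p))

/-- **H3′ (k1/k2 H3 with the residual in place of `Carayol1986_eulerFactor`, at a place `v` with
`q_v ∥ N`).**  `L_v(W, T) = 1 - a_q(f₀) T + ε(q) q T²` in `ℂ[T]` for `q = q_v ∥ N`, `v ∤ p'`: the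
residual on `ρ_g`, transported along `ρ_g ≅ VQ ⊗ ℚ̄_{p'}` (`he`), along base change and along the
framing `eV` to `V_{p'} W`, whose coinvariant characteristic polynomial is `L_v(W,T)` reversed
(`reverse_charpoly_toInertiaCoinvariants_eq_localPolynomialAt'`, PROVED, all reduction types).
PROVED (H3's body verbatim; only the line invoking the fact changes). -/
theorem H3'_map_localPolynomialAt_eq_of_dvd (hSC : Newform0SteinbergCoinvariants)
    (W : WeierstrassCurve ℚ) [W.IsElliptic] {N : ℕ} [NeZero N] (f₀ : CuspForm (Gamma0 N) 2)
    (hf₀ : IsNewform0 f₀) (p' : ℕ) [Fact p'.Prime] (ι : PadicAlgCl p' ≃+* ℂ)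
    (ρg : FramedGaloisRep ℚ (PadicAlgCl p') 2)
    (hρg : IsGaloisRepOfNewform1 (liftToGamma1 N 2 f₀)
      ((ι.symm : ℂ →+* PadicAlgCl p').comp (algebraMap (coeffCharField (liftToGamma1 N 2 f₀)) ℂ))
      {q | q ∣ N * p'} ρg)
    (hirr : ρg.toGaloisRep.IsIrreducible)
    (VQ : FramedGaloisRep ℚ ℚ_[p'] 2) (eV : (Fin 2 → ℚ_[p']) ≃ₗ[ℚ_[p']] W.rationalTateModule p')
    (heV : ∀ (σ : absoluteGaloisGroup ℚ) (x : Fin 2 → ℚ_[p']),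
      eV (FramedRep.toRepresentation VQ σ x) = W.rationalGaloisRepTate p' σ (eV x))
    (he : Nonempty (ContinuousRep.Equiv ρg.toGaloisRep
      (FramedGaloisRep.toGaloisRep
        (VQ.baseChange (algebraMap ℚ_[p'] (PadicAlgCl p')) (continuous_algebraMap_padicAlgCl p')))))
    (v : HeightOneSpectrum (𝓞 ℚ)) (hv : (p' : 𝓞 ℚ) ∉ v.asIdeal)
    (hvN : (primesEquiv v : ℕ) ∣ N) (hv2 : ¬ (primesEquiv v : ℕ) ^ 2 ∣ N) :
    (W.localPolynomialAt v).map (Int.castRingHom ℂ) =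
      1 - C (cuspCoeff f₀ (primesEquiv v : ℕ)) * X +
        C ((nebentypus (liftToGamma1 N 2 f₀) ((primesEquiv v : ℕ) : ZMod N) : ℂ) *
          ((primesEquiv v : ℕ) : ℂ)) * X ^ 2 := by
  classical
  haveI := W.module_finite_rationalTateModule_holds p'
  have hq : (primesEquiv v : ℕ).Prime := (primesEquiv v).2
  have hqv : ((primesEquiv v : ℕ) : 𝓞 ℚ) ∈ v.asIdeal := by
    rw [Literature.NumberTheory.GaloisRepresentations.Rat.natCast_mem_asIdeal_iff]
    exact dvd_of_eq (show natGenerator v = (primesEquiv v : ℕ) from rfl)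
  have hqp' : (primesEquiv v : ℕ) ≠ p' := fun h ↦ hv (h ▸ hqv)
  -- a prime `𝔔 ∣ v` of `ℤ̄` and an arithmetic Frobenius `σ ∈ D_𝔔`
  obtain ⟨𝔔, h𝔔⟩ := primesAbove_nonempty v
  haveI : 𝔔.IsPrime := h𝔔.1
  obtain ⟨σ₀, hσ₀⟩ := exists_isArithFrobAt_of_mem_primesAbove_holds (v := v) h𝔔
  set σ : 𝔔.decompositionSubgroup (absoluteGaloisGroup ℚ) := ⟨σ₀, hσ₀.mem_stabilizer⟩ with hσdef
  have hσ : IsArithFrobAt (𝓞 ℚ) (σ : absoluteGaloisGroup ℚ) 𝔔 := hσ₀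
  -- (1) the residual for `ρ_g`, `g` the lift of `f₀`, at the place `q ∥ N`
  have h1 := hSC f₀ hf₀ p' ι ρg hρg hirr (primesEquiv v : ℕ) hq hqp' hvN hv2 v hqv 𝔔 h𝔔 σ hσ
  -- (2) `ρ_g ≅ V ⊗ ℚ̄_{p'}`: isomorphic representations have the same coinvariant charpolys
  obtain ⟨e⟩ := he
  have he' : ∀ (γ : absoluteGaloisGroup ℚ) (x : Fin 2 → PadicAlgCl p'),
      e.toLinearEquiv (ρg.toGaloisRep γ x) = (FramedGaloisRep.toGaloisRep
        (VQ.baseChange (algebraMap ℚ_[p'] (PadicAlgCl p')) (continuous_algebraMap_padicAlgCl p')))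
          γ (e.toLinearEquiv x) :=
    fun γ x ↦ LinearMap.congr_fun (e.isIntertwining' γ) x
  have hconj := ContinuousRep.inertiaCoinvariantsCongr_conj_toInertiaCoinvariants _ _
    e.toLinearEquiv he' 𝔔 σ
  have h2 : ((FramedGaloisRep.toGaloisRep (VQ.baseChange (algebraMap ℚ_[p'] (PadicAlgCl p'))
      (continuous_algebraMap_padicAlgCl p'))).toInertiaCoinvariants 𝔔 σ).charpoly =
      (ρg.toGaloisRep.toInertiaCoinvariants 𝔔 σ).charpoly := by
    rw [← hconj, LinearEquiv.charpoly_conj]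
  rw [← h2] at h1
  -- (3) coinvariants commute with the base change `ℚ_{p'} → ℚ̄_{p'}`
  have hbc : ((FramedGaloisRep.toGaloisRep (VQ.baseChange (algebraMap ℚ_[p'] (PadicAlgCl p'))
      (continuous_algebraMap_padicAlgCl p'))).toInertiaCoinvariants 𝔔 σ).charpoly =
      (((FramedGaloisRep.toGaloisRep VQ).toInertiaCoinvariants 𝔔 σ).charpoly).map
        (algebraMap ℚ_[p'] (PadicAlgCl p')) :=
    charpoly_toCoinvariants_map (algebraMap ℚ_[p'] (PadicAlgCl p'))
      ((VQ : absoluteGaloisGroup ℚ →* GL (Fin 2) ℚ_[p']).comp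
        (𝔔.decompositionSubgroup (absoluteGaloisGroup ℚ)).subtype)
      (𝔔.inertia (𝔔.decompositionSubgroup (absoluteGaloisGroup ℚ))) σ
  have hrev : ∀ {P : ℚ_[p'][X]}, P.Monic →
      (P.map (algebraMap ℚ_[p'] (PadicAlgCl p'))).reverse =
        P.reverse.map (algebraMap ℚ_[p'] (PadicAlgCl p')) := fun hP ↦ by
    rw [Polynomial.reverse, Polynomial.reverse, hP.natDegree_map, Polynomial.reflect_map]
  rw [hbc, hrev (LinearMap.charpoly_monic _)] at h1
  -- (4) the framing `V ≅ V_{p'}(E)` and the `E`-side Euler factor `L_v(E, T)`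
  have hcW := W.continuous_rationalGaloisRepTate_holds p'
  have heV' : ∀ (γ : absoluteGaloisGroup ℚ) (x : Fin 2 → ℚ_[p']),
      eV ((FramedGaloisRep.toGaloisRep VQ) γ x) =
        (rationalTateGaloisRepOf (geomPoints W) p' hcW) γ (eV x) := fun γ x ↦ heV γ x
  have hconj₂ := ContinuousRep.inertiaCoinvariantsCongr_conj_toInertiaCoinvariants _ _ eV heV' 𝔔 σ
  have h3 : ((rationalTateGaloisRepOf (geomPoints W) p' hcW).toInertiaCoinvariants 𝔔 σ).charpoly =
      ((FramedGaloisRep.toGaloisRep VQ).toInertiaCoinvariants 𝔔 σ).charpoly := by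
    rw [← hconj₂, LinearEquiv.charpoly_conj]
  have hE := W.reverse_charpoly_toInertiaCoinvariants_eq_localPolynomialAt' p' hv h𝔔 σ hσ
  rw [h3] at hE
  rw [hE, Polynomial.map_map] at h1
  -- (5) read everything in `ℂ` through `ι`
  have h4 := congrArg (Polynomial.map (ι : PadicAlgCl p' →+* ℂ)) h1
  rw [Polynomial.map_map, RingHom.eq_intCast' (((ι : PadicAlgCl p' →+* ℂ).comp
    ((algebraMap ℚ_[p'] (PadicAlgCl p')).comp (Int.castRingHom ℚ_[p']))))] at h4
  rw [h4]
  have h21 : ((2 : ℤ) - 1) = 1 := by norm_num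
  have hcc : cuspCoeff (liftToGamma1 N 2 f₀) (primesEquiv v : ℕ) = cuspCoeff f₀ (primesEquiv v : ℕ) := by
    rw [cuspCoeff, cuspCoeff, coe_liftToGamma1_holds N 2 f₀]
  simp only [Polynomial.map_add, Polynomial.map_sub, Polynomial.map_mul, Polynomial.map_pow,
    Polynomial.map_one, map_X, map_C, RingEquiv.coe_toRingHom, RingEquiv.apply_symm_apply, h21,
    zpow_one, hcc]

/-- **H5 — `SteinbergSignPacket ⇐ Newform0SteinbergCoinvariants` (PROVED; closes k3 gen 5's L2a
without `L_A` / cofinality and without the Euler-factor fact off `p ∥ N`).**  Given the packet at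
level `N` and a prime `p ∥ N`: choose ONE prime `ℓ > p` with `V_ℓ W` irreducible
(`exists_prime_gt_isIrreducible_rationalGaloisRepTate`), realise the lift of `f₀` on `V_ℓ W ⊗ ℚ̄_ℓ`
(R), apply H3′ with `he := refl` at the place `v = (p)`, and read the `T`-coefficient (H4):
`a_p(f₀) = a_p(W)`.  (The hypothesis `N = N_W` of the packet is not even used.)
[cite: DarmonDiamondTaylor1995, Thm. 3.1 (e)] [cite: CarayolASENS1986, Thm. (A)] -/
theorem steinbergSignPacket_of_newform0SteinbergCoinvariants (hSC : Newform0SteinbergCoinvariants) :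
    SteinbergSignPacket := by
  intro W _ N _ f₀ hf₀ _ hgood hap p hp hpN hp2
  classical
  -- an auxiliary prime `ℓ > p` with `V_ℓ W` irreducible, `ι : ℚ̄_ℓ ≃ ℂ`, and the realisation
  obtain ⟨ℓ, hℓF, hpℓ, hirrW⟩ := W.exists_prime_gt_isIrreducible_rationalGaloisRepTate p
  haveI := hℓF
  obtain ⟨ι⟩ := PadicAlgCl.nonempty_ringEquiv_complex ℓ
  obtain ⟨VQ, eV, heV, hρg, hirr⟩ :=
    realisation_baseChange_rationalTate_of_packet W f₀ hf₀ hgood hap ℓ ι hirrW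
  -- the place `v` of `ℚ` at `p` (so `v ∤ ℓ`)
  set v : HeightOneSpectrum (𝓞 ℚ) := primesEquiv.symm ⟨p, hp⟩ with hvdef
  have hvq : (primesEquiv v : ℕ) = p := by rw [hvdef, Equiv.apply_symm_apply]
  have hne : (primesEquiv v : ℕ) ≠ ℓ := by rw [hvq]; exact ne_of_lt hpℓ
  have hv : (ℓ : 𝓞 ℚ) ∉ v.asIdeal := natCast_not_mem_asIdeal_of_primesEquiv_ne hℓF.out hne
  have hvN : (primesEquiv v : ℕ) ∣ N := by rw [hvq]; exact hpN
  have hv2 : ¬ (primesEquiv v : ℕ) ^ 2 ∣ N := by rw [hvq]; exact hp2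
  have H := H4_cuspCoeff_eq_and_dvd_iff W f₀ hf₀ v
    (H3'_map_localPolynomialAt_eq_of_dvd hSC W f₀ hf₀ ℓ ι _ hρg hirr VQ eV heV
      ⟨ContinuousRep.Equiv.refl _⟩ v hv hvN hv2)
  rw [hvq] at H
  exact H.1

/-! ## Ported PROVED blocks of k3 gen 5 (L0 level leaf on the packet, L1 elementary assembly) — verbatim -/

section LevelLeaf

variable (W : WeierstrassCurve ℚ) [W.IsElliptic] {N : ℕ} [NeZero N] (f₀ : CuspForm (Gamma0 N) 2)

omit [W.IsElliptic] in
/-- A `Γ₀(N)`-newform is not the zero form (`a₁ = 1`). [folklore] -/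
theorem ne_zero_of_isNewform0 (hf₀ : IsNewform0 f₀) : f₀ ≠ 0 := by
  intro h0
  have h1 : cuspCoeff f₀ 1 = 1 := hf₀.2.2
  rw [h0, cuspCoeff, CuspForm.coe_zero, UpperHalfPlane.qExpansion_zero, map_zero] at h1
  exact zero_ne_one h1

omit [W.IsElliptic] in
/-- **The Hecke polynomial of the `Γ₁(N)`-lift of `f₀` at a prime `q ∤ N` carrying `a_q(W)`**, read in
`ℚ̄_ℓ`: `X² - a_q(W) X + q` (the tree's private `IsNewformOf.map_heckePolynomial_liftToGamma1` with
`IsNewformOf` weakened to the single coefficient `a_q(f₀) = a_q(W)`). [folklore] -/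
theorem map_heckePolynomial_liftToGamma1_of_cuspCoeff_eq (hne : f₀ ≠ 0) (ℓ : ℕ) [Fact ℓ.Prime]
    (ι : PadicAlgCl ℓ ≃+* ℂ) {q : ℕ} (hq : q.Prime) (hqN : ¬ q ∣ N)
    (ha : cuspCoeff f₀ q = (W.LFunction q : ℂ)) :
    (heckePolynomial (liftToGamma1 N 2 f₀) q).map
        ((ι.symm : ℂ →+* PadicAlgCl ℓ).comp (algebraMap (coeffCharField (liftToGamma1 N 2 f₀)) ℂ)) =
      X ^ 2 - C ((W.LFunction q : ℤ) : PadicAlgCl ℓ) * X + C ((q : ℕ) : PadicAlgCl ℓ) := by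
  rw [← Polynomial.map_map, map_heckePolynomial, coe_liftToGamma1_holds N 2 f₀]
  have ha' : (UpperHalfPlane.qExpansion 1 ⇑f₀).coeff q = (W.LFunction q : ℂ) := ha
  have hε : nebentypus (liftToGamma1 N 2 f₀) (q : ZMod N) = 1 := by
    rw [nebentypus_liftToGamma1_holds N 2 hne,
      MulChar.one_apply ((ZMod.isUnit_prime_iff_not_dvd hq).mpr hqN)]
  rw [ha', hε]
  have h21 : ((2 : ℤ) - 1) = 1 := by norm_num
  simp [Polynomial.map_sub, Polynomial.map_add, Polynomial.map_mul, h21]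

/-- **L0a — the `ℓ`-adic Tate module of `W` is an irreducible `ℓ`-adic representation attached to the
lift of the PACKET newform `f₀`.**  For an elliptic `W/ℚ`, a newform `f₀ ∈ S₂(Γ₀(N))` with `W` good off
`N` and `a_p(f₀) = a_p(W)` for every prime `p ∤ N` (k2's packet; NO hypothesis at `p ∣ N`), a prime `ℓ`
with `V_ℓ W` irreducible and `ι : ℚ̄_ℓ ≃ ℂ`: a framed model of `V_ℓ W ⊗ ℚ̄_ℓ` is attached to
`liftToGamma1 N 2 f₀` away from `N ℓ`, is irreducible, and has Artin exponent `a_w(V_ℓ W)` at every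
`w ∤ ℓ`.  Port of the tree's `IsNewformOf.exists_isGaloisRepOfNewform1_rationalTate`
(`CuspFormLFunctionLevelConductorCarayolProofs`), whose proof used `IsNewformOf` only through
`a_q(f) = a_q(W)` and good reduction at `q ∤ N`.
[cite: DarmonDiamondTaylor1995, Thm. 3.1 (b), (c) and p. 87] [cite: SilvermanAEC2009, C.21 Remark 21.3] -/
theorem exists_isGaloisRepOfNewform1_rationalTate_of_packet (hf₀ : IsNewform0 f₀)
    (hgood : ∀ v : HeightOneSpectrum (𝓞 ℚ), ¬ ((primesEquiv v : ℕ) ∣ N) → W.HasGoodReductionAt v)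
    (hap : ∀ p : ℕ, p.Prime → ¬ p ∣ N → cuspCoeff f₀ p = (W.LFunction p : ℂ))
    (ℓ : ℕ) [Fact ℓ.Prime] (ι : PadicAlgCl ℓ ≃+* ℂ)
    (hirr : (W.rationalGaloisRepTate ℓ).IsIrreducible) :
    ∃ ρ : FramedGaloisRep ℚ (PadicAlgCl ℓ) 2,
      IsGaloisRepOfNewform1 (liftToGamma1 N 2 f₀)
          ((ι.symm : ℂ →+* PadicAlgCl ℓ).comp (algebraMap (coeffCharField (liftToGamma1 N 2 f₀)) ℂ))
          {q | q ∣ N * ℓ} ρ ∧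
        ρ.toGaloisRep.IsIrreducible ∧
        ∀ w : HeightOneSpectrum (𝓞 ℚ), (ℓ : 𝓞 ℚ) ∉ w.asIdeal →
          ρ.toGaloisRep.artinConductorExponent w =
            conductorExponentOf (WeierstrassCurve.geomPoints W) ℓ
              (W.continuous_rationalGaloisRepTate_holds ℓ) w := by
  classical
  have hℓp : ℓ.Prime := Fact.out
  have hne : f₀ ≠ 0 := ne_zero_of_isNewform0 f₀ hf₀
  obtain ⟨VQ, eV, heV, hV⟩ := exists_framedGaloisRep_rationalTate W ℓ
  set iE := algebraMap ℚ_[ℓ] (PadicAlgCl ℓ) with hiE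
  have hiEc : Continuous iE := continuous_algebraMap_padicAlgCl ℓ
  have hcW := W.continuous_rationalGaloisRepTate_holds ℓ
  have heV' : ∀ (g : absoluteGaloisGroup ℚ) (x : Fin 2 → ℚ_[ℓ]),
      eV (VQ.toGaloisRep g x) =
        rationalTateGaloisRepOf (WeierstrassCurve.geomPoints W) ℓ hcW g (eV x) := heV
  refine ⟨FramedRep.baseChange iE hiEc VQ, ?_, ?_, ?_⟩
  · -- attached to the lift of `f₀` away from `N ℓ`
    intro v hvS
    set q : ℕ := ((primesEquiv v : Nat.Primes) : ℕ) with hqdef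
    have hq : q.Prime := (primesEquiv v).2
    simp only [Set.mem_setOf_eq] at hvS
    have hqN : ¬ q ∣ N := fun h ↦ hvS (h.trans (dvd_mul_right N ℓ))
    have hqℓ : q ≠ ℓ := fun h ↦ hvS (h ▸ dvd_mul_left q N)
    have hℓv : (ℓ : 𝓞 ℚ) ∉ v.asIdeal := by
      rw [Rat.natCast_mem_asIdeal_iff]
      intro h
      exact hqℓ ((Nat.prime_dvd_prime_iff_eq hq hℓp).mp h)
    have hgoodv : W.HasGoodReductionAt v := hgood v hqN
    obtain ⟨hVu, hVf⟩ := hV v hℓv hgoodv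
    refine ⟨(FramedGaloisRep.isUnramifiedAt_baseChange_iff iE hiEc iE.injective v VQ).mpr hVu, ?_⟩
    rw [map_heckePolynomial_liftToGamma1_of_cuspCoeff_eq W f₀ hne ℓ ι hq hqN (hap q hq hqN)]
    have hVf' := FramedGaloisRep.hasFrobCharpolyAt_baseChange iE hiEc hVf
    have hmapQ : (X ^ 2 - C ((W.LFunction q : ℤ) : ℚ_[ℓ]) * X + C (q : ℚ_[ℓ]) : ℚ_[ℓ][X]).map iE =
        X ^ 2 - C ((W.LFunction q : ℤ) : PadicAlgCl ℓ) * X + C (q : PadicAlgCl ℓ) := by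
      simp
    rw [hmapQ] at hVf'
    exact hVf'
  · -- irreducible: `V_ℓ W` is odd and irreducible, hence absolutely irreducible
    have hirrQ : FramedRep.IsIrreducible VQ :=
      (Representation.isIrreducible_iff_of_equivariant VQ.toRepresentation (W.rationalGaloisRepTate ℓ)
        (MonoidHom.id _) Function.surjective_id eV heV).mpr hirr
    obtain ⟨c, hc⟩ := exists_isComplexConjugation (Rat.castHom ℝ)
    have hcc : c * c = 1 := by rw [← pow_two]; exact hc.sq_eq_one
    have hdet : Matrix.GeneralLinearGroup.det (VQ c) = -1 := by
      apply Units.ext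
      rw [Matrix.GeneralLinearGroup.val_det_apply, Units.val_neg, Units.val_one]
      have h1 : ((VQ c : GL (Fin 2) ℚ_[ℓ]) : Matrix (Fin 2) (Fin 2) ℚ_[ℓ]).det =
          LinearMap.det (VQ.toRepresentation c) := by
        rw [← LinearMap.det_toLin']
        rfl
      have h2 : LinearMap.det (VQ.toRepresentation c) =
          LinearMap.det (W.rationalGaloisRepTate ℓ c) := by
        have hconj : (W.rationalGaloisRepTate ℓ c : W.rationalTateModule ℓ →ₗ[ℚ_[ℓ]] _) =
            (eV : (Fin 2 → ℚ_[ℓ]) →ₗ[ℚ_[ℓ]] W.rationalTateModule ℓ) ∘ₗ VQ.toRepresentation c ∘ₗ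
              (eV.symm : W.rationalTateModule ℓ →ₗ[ℚ_[ℓ]] (Fin 2 → ℚ_[ℓ])) := by
          apply LinearMap.ext
          intro y
          simp only [LinearMap.coe_comp, LinearEquiv.coe_coe, Function.comp_apply]
          rw [heV, LinearEquiv.apply_symm_apply]
        rw [hconj, LinearMap.det_conj]
      rw [h1, h2, Literature.AlgebraicGeometry.Motives.det_rationalGaloisRepTate_eq_cyclotomicCharacter
        W ℓ c, GaloisRep.cyclotomicCharacter_of_isComplexConjugation ℓ hc, map_neg, map_one]
    have habs : FramedRep.IsAbsolutelyIrreducible VQ :=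
      FramedRep.isAbsolutelyIrreducible_of_isIrreducible_of_det_eq_neg_one VQ hirrQ two_ne_zero hcc
        hdet
    exact habs (PadicAlgCl ℓ) iE
  · -- conductor exponents away from `ℓ`
    intro w _
    rw [FramedGaloisRep.artinConductorExponent_toGaloisRep_baseChange]
    exact GaloisRep.artinConductorExponent_eq_of_equiv VQ.toGaloisRep
      (rationalTateGaloisRepOf (WeierstrassCurve.geomPoints W) ℓ hcW) eV heV' w

/-- **L0b — `v_q(N) = f_w(W)` for the packet at every prime `q` away from the additive places of
residue characteristic `2`, granted Carayol's conductor theorem** (the named fact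
`Carayol1986_artinConductorExponent`, Carayol 1986 Thm. (A) / Darmon–Diamond–Taylor Thm. 3.1 (d)):
choose `ℓ > q` with `V_ℓ W` irreducible (`exists_prime_gt_isIrreducible_rationalGaloisRepTate`), apply
L0a and read `a_w(V_ℓ W) = f_w(W)` by Ogg's formula in Galois form
(`conductorExponentOf_geomPoints_eq_conductorExponent_of_ringChar_two_imp`).
[cite: CarayolASENS1986, Thm. (A), (0.8) Corollaire (pp. 410–411)]
[cite: DarmonDiamondTaylor1995, Thm. 3.1 (d) with §2.1 (p. 54)] [cite: SilvermanATAEC1994, Thm. IV.10.2, IV.11.1] -/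
theorem padicValNat_level_eq_conductorExponent_of_carayol1986_of_packet
    (hC : Carayol1986_artinConductorExponent) (hf₀ : IsNewform0 f₀)
    (hgood : ∀ v : HeightOneSpectrum (𝓞 ℚ), ¬ ((primesEquiv v : ℕ) ∣ N) → W.HasGoodReductionAt v)
    (hap : ∀ p : ℕ, p.Prime → ¬ p ∣ N → cuspCoeff f₀ p = (W.LFunction p : ℂ))
    {q : ℕ} (hq : q.Prime) (w : HeightOneSpectrum (𝓞 ℚ)) (hqw : (q : 𝓞 ℚ) ∈ w.asIdeal)
    (h2 : ringChar (𝓞 ℚ ⧸ w.asIdeal) = 2 → ¬ W.HasAdditiveReductionAt w) :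
    padicValNat q N = W.conductorExponent w := by
  obtain ⟨ℓ, hℓ, hqℓ, hirr⟩ := W.exists_prime_gt_isIrreducible_rationalGaloisRepTate q
  haveI := hℓ
  obtain ⟨ι⟩ := PadicAlgCl.nonempty_ringEquiv_complex ℓ
  obtain ⟨ρ, hρ, hirrρ, hcond⟩ :=
    exists_isGaloisRepOfNewform1_rationalTate_of_packet W f₀ hf₀ hgood hap ℓ ι hirr
  have hnew : IsNewform1 (liftToGamma1 N 2 f₀) := (isNewform1_liftToGamma1_iff_holds N 2 f₀).mpr hf₀
  have hqw' : natGenerator w = q :=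
    (Nat.prime_dvd_prime_iff_eq (primesEquiv w).2 hq).mp ((Rat.natCast_mem_asIdeal_iff w).mp hqw)
  have hℓw : (ℓ : 𝓞 ℚ) ∉ w.asIdeal := by
    rw [Rat.natCast_mem_asIdeal_iff, hqw']
    intro h
    exact (ne_of_lt hqℓ) ((Nat.prime_dvd_prime_iff_eq hq hℓ.out).mp h)
  have key := hC (liftToGamma1 N 2 f₀) le_rfl hnew ℓ ι ρ hρ hirrρ q hq (ne_of_lt hqℓ) w hqw
  rw [← key, hcond w hℓw]
  exact W.conductorExponentOf_geomPoints_eq_conductorExponent_of_ringChar_two_imp ℓ _ w hℓw h2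

omit [NeZero N] in
/-- `N = N_W` exponentwise (copy of the tree's private
`eq_conductorNorm_of_forall_padicValNat_eq_conductorExponent`). [folklore] -/
theorem eq_conductorNorm_of_forall_padicValNat_eq_conductorExponent' (hN : N ≠ 0)
    (h : ∀ q : ℕ, q.Prime → ∀ w : HeightOneSpectrum (𝓞 ℚ), (q : 𝓞 ℚ) ∈ w.asIdeal →
      padicValNat q N = W.conductorExponent w) :
    N = W.conductorNorm ℤ := by
  refine Nat.eq_of_factorization_eq hN (W.conductorNorm_pos_holds).ne' fun q ↦ ?_
  by_cases hq : q.Prime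
  · set q' : Nat.Primes := ⟨q, hq⟩ with hq'
    set w : HeightOneSpectrum (𝓞 ℚ) := (primesEquiv (R := 𝓞 ℚ)).symm q' with hw
    have hpw : (primesEquiv w : Nat.Primes) = q' := Equiv.apply_symm_apply _ _
    have hqw : (q : 𝓞 ℚ) ∈ w.asIdeal :=
      (Rat.natCast_mem_asIdeal_iff w).mpr (by rw [show natGenerator w = q from congrArg Subtype.val hpw])
    have hgen : natGenerator ((primesEquiv (R := ℤ)).symm q') = q :=
      congrArg (fun x : Nat.Primes ↦ (x : ℕ)) (Equiv.apply_symm_apply (primesEquiv (R := ℤ)) q')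
    rw [Nat.factorization_def _ hq, h q hq w hqw, W.conductorExponent_ringOfIntegers_eq w,
      ← W.factorization_conductorNorm_holds ((primesEquiv (R := ℤ)).symm (primesEquiv w)), hpw, hgen]
  · rw [Nat.factorization_eq_zero_of_not_prime _ hq, Nat.factorization_eq_zero_of_not_prime _ hq]

/-- **L0c — level `=` conductor for the PACKET, for a curve not additive at `2`, modulo Carayol (A)
alone.** [cite: CarayolASENS1986, Thm. (A), (0.8) Corollaire] [cite: DarmonDiamondTaylor1995, Thm. 3.1 (d)] -/
theorem level_eq_conductorNorm_of_carayol1986_of_packet_of_not_additive_two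
    (hC : Carayol1986_artinConductorExponent) (hf₀ : IsNewform0 f₀)
    (hgood : ∀ v : HeightOneSpectrum (𝓞 ℚ), ¬ ((primesEquiv v : ℕ) ∣ N) → W.HasGoodReductionAt v)
    (hap : ∀ p : ℕ, p.Prime → ¬ p ∣ N → cuspCoeff f₀ p = (W.LFunction p : ℂ))
    (h2 : ∀ w : HeightOneSpectrum (𝓞 ℚ), ringChar (𝓞 ℚ ⧸ w.asIdeal) = 2 →
      ¬ W.HasAdditiveReductionAt w) :
    N = W.conductorNorm ℤ :=
  eq_conductorNorm_of_forall_padicValNat_eq_conductorExponent' W (NeZero.ne N) fun _ hq w hqw ↦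
    padicValNat_level_eq_conductorExponent_of_carayol1986_of_packet W f₀ hC hf₀ hgood hap hq w hqw (h2 w)

/-- **L0c' — level `=` conductor for the PACKET, for EVERY elliptic `W/ℚ`, modulo Carayol (A) and
Saito's `p = 2` leaf of Ogg's formula for `W`** (the named fact
`W.swanConductorAt_rationalTate_eq_wildConductorExponent_of_ringChar_eq_two ℓ`, Saito 1988; for `W`
with `ord₂ j ≤ 0` a theorem of the tree, in general gen-4 k3's residual `SaitoTwoSupersingular`).
[cite: CarayolASENS1986, Thm. (A), (0.8) Corollaire] [cite: Saito1988, Theorem 1]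
[cite: DiamondShurman2005, Thm. 8.8.1] -/
theorem level_eq_conductorNorm_of_carayol1986_of_saito_of_packet
    (hC : Carayol1986_artinConductorExponent)
    (hS : ∀ (ℓ : ℕ) [Fact ℓ.Prime],
      W.swanConductorAt_rationalTate_eq_wildConductorExponent_of_ringChar_eq_two ℓ)
    (hf₀ : IsNewform0 f₀)
    (hgood : ∀ v : HeightOneSpectrum (𝓞 ℚ), ¬ ((primesEquiv v : ℕ) ∣ N) → W.HasGoodReductionAt v)
    (hap : ∀ p : ℕ, p.Prime → ¬ p ∣ N → cuspCoeff f₀ p = (W.LFunction p : ℂ)) :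
    N = W.conductorNorm ℤ := by
  refine eq_conductorNorm_of_forall_padicValNat_eq_conductorExponent' W (NeZero.ne N)
    fun q hq w hqw ↦ ?_
  obtain ⟨ℓ, hℓ, hqℓ, hirr⟩ := W.exists_prime_gt_isIrreducible_rationalGaloisRepTate q
  haveI := hℓ
  obtain ⟨ι⟩ := PadicAlgCl.nonempty_ringEquiv_complex ℓ
  obtain ⟨ρ, hρ, hirrρ, hcond⟩ :=
    exists_isGaloisRepOfNewform1_rationalTate_of_packet W f₀ hf₀ hgood hap ℓ ι hirr
  have hnew : IsNewform1 (liftToGamma1 N 2 f₀) := (isNewform1_liftToGamma1_iff_holds N 2 f₀).mpr hf₀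
  have hqw' : natGenerator w = q :=
    (Nat.prime_dvd_prime_iff_eq (primesEquiv w).2 hq).mp ((Rat.natCast_mem_asIdeal_iff w).mp hqw)
  have hℓw : (ℓ : 𝓞 ℚ) ∉ w.asIdeal := by
    rw [Rat.natCast_mem_asIdeal_iff, hqw']
    intro h
    exact (ne_of_lt hqℓ) ((Nat.prime_dvd_prime_iff_eq hq hℓ.out).mp h)
  have key := hC (liftToGamma1 N 2 f₀) le_rfl hnew ℓ ι ρ hρ hirrρ q hq (ne_of_lt hqℓ) w hqw
  rw [← key, hcond w hℓw]
  exact W.artinConductorExponent_tate_eq_conductorExponent_of_isElliptic_of_two ℓ (hS ℓ) _ w hℓw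

end LevelLeaf

/-! ## L1 — the elementary assembly: packet + `N = N_W` + the sign at `p ∥ N` ⇒ `IsNewformOf` -/

section Assembly

variable (W : WeierstrassCurve ℚ) [W.IsElliptic] {N : ℕ} [NeZero N] (f₀ : CuspForm (Gamma0 N) 2)

/-- **L1 — EXTREMAL SPLIT (elementary).**  For an elliptic `W/ℚ` and a newform `f₀ ∈ S₂(Γ₀(N))` at
level `N = N_W` with `a_p(f₀) = a_p(W)` at every prime `p ∤ N` AND at every prime `p ∥ N`, one has
`aₙ(f₀) = aₙ(W)` for all `n` (`IsNewformOf W f₀`): at `p² ∣ N` both sides vanish (`a_p(f₀) = 0`,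
Atkin–Lehner Thm. 3, `IsNewform0.cuspCoeff_eq_zero_of_sq_dvd`; `p² ∣ N_W ⇔` additive reduction,
Silverman ATAEC IV.10.2 (c), `two_le_conductorExponent_iff_holds`, and `a_p(W) = 0` there,
`LFunction_apply_eq_zero_of_hasAdditiveReductionAt`), and the two multiplicative sequences with equal
prime values and the same prime-power recursions coincide (`isNewformOf_of_forall_prime_cuspCoeff_eq`,
Diamond–Shurman (8.43)–(8.44)).  So the minimal `n` with `aₙ(f₀) ≠ aₙ(W)` is a prime `p ∥ N`, where
both values are signs.  [cite: AtkinLehner1970, Thm. 3] [cite: DiamondShurman2005, §8.8 (8.43)–(8.44), Thm. 8.8.3]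
[cite: SilvermanATAEC1994, Thm. IV.10.2] -/
theorem isNewformOf_of_packet_of_level_eq_of_sign (hf₀ : IsNewform0 f₀) (hN : N = W.conductorNorm ℤ)
    (hap : ∀ p : ℕ, p.Prime → ¬ p ∣ N → cuspCoeff f₀ p = (W.LFunction p : ℂ))
    (hsign : ∀ p : ℕ, p.Prime → p ∣ N → ¬ p ^ 2 ∣ N → cuspCoeff f₀ p = (W.LFunction p : ℂ)) :
    IsNewformOf W f₀ := by
  subst hN
  refine isNewformOf_of_forall_prime_cuspCoeff_eq (fun u ↦ conductorExponent_eq_zero_iff_holds u W)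
    hf₀ fun p hp ↦ ?_
  by_cases hpN : p ∣ W.conductorNorm ℤ
  · by_cases hp2 : p ^ 2 ∣ W.conductorNorm ℤ
    · -- additive prime: `a_p(f₀) = 0 = a_p(W)`
      rw [hf₀.cuspCoeff_eq_zero_of_sq_dvd hp hp2]
      haveI : Fact p.Prime := ⟨hp⟩
      set w : HeightOneSpectrum (𝓞 ℚ) := (primesEquiv (R := 𝓞 ℚ)).symm ⟨p, hp⟩ with hw
      have hpw : (primesEquiv w : Nat.Primes) = ⟨p, hp⟩ := Equiv.apply_symm_apply _ _
      have hgen : natGenerator ((primesEquiv (R := ℤ)).symm (primesEquiv w)) = p := by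
        rw [hpw]
        exact congrArg (fun x : Nat.Primes ↦ (x : ℕ))
          (Equiv.apply_symm_apply (primesEquiv (R := ℤ)) ⟨p, hp⟩)
      have h2f : 2 ≤ W.conductorExponent w := by
        have h1 : 2 ≤ (W.conductorNorm ℤ).factorization p :=
          (hp.pow_dvd_iff_le_factorization (NeZero.ne _)).mp hp2
        rw [W.conductorExponent_ringOfIntegers_eq w,
          ← W.factorization_conductorNorm_holds ((primesEquiv (R := ℤ)).symm (primesEquiv w)), hgen]
        exact h1
      have hadd : W.HasAdditiveReductionAt w := (two_le_conductorExponent_iff_holds w W).mp h2f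
      have hv : ((primesEquiv w : Nat.Primes) : ℕ) = p := by rw [hpw]
      rw [W.LFunction_apply_eq_zero_of_hasAdditiveReductionAt hv hadd (dvd_refl p), Int.cast_zero]
    · exact hsign p hp hpN hp2
  · exact hap p hp hpN

end Assembly

/-! ## Closers (kernel-checked glue) -/

section Closers

/-- **M3 recut: the packet IS the newform of `W`, and its level is `N_W`** — from Carayol (A), Saito's
leaf for `W`, and the Steinberg sign bit (no `Carayol1986_eulerFactor`, no Eichler–Shimura).
[cite: CarayolASENS1986, Thm. (A), (0.8) Corollaire] [cite: DarmonDiamondTaylor1995, Thm. 3.1 (d), (e)] -/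
theorem isNewformOf_of_packet_of_carayol1986_of_saito_of_sign (hC : Carayol1986_artinConductorExponent)
    (hSign : SteinbergSignPacket) (W : WeierstrassCurve ℚ) [W.IsElliptic] [NeZero (W.conductorNorm ℤ)]
    (hS : ∀ (ℓ : ℕ) [Fact ℓ.Prime],
      W.swanConductorAt_rationalTate_eq_wildConductorExponent_of_ringChar_eq_two ℓ)
    {N : ℕ} [NeZero N] (f₀ : CuspForm (Gamma0 N) 2) (hf₀ : IsNewform0 f₀)
    (hgood : ∀ v : HeightOneSpectrum (𝓞 ℚ), ¬ ((primesEquiv v : ℕ) ∣ N) → W.HasGoodReductionAt v)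
    (hap : ∀ p : ℕ, p.Prime → ¬ p ∣ N → cuspCoeff f₀ p = (W.LFunction p : ℂ)) :
    IsNewformOf W f₀ ∧ N = W.conductorNorm ℤ := by
  have hN : N = W.conductorNorm ℤ :=
    level_eq_conductorNorm_of_carayol1986_of_saito_of_packet W f₀ hC hS hf₀ hgood hap
  exact ⟨isNewformOf_of_packet_of_level_eq_of_sign W f₀ hf₀ hN hap
    (hSign W f₀ hf₀ hN hgood hap), hN⟩

/-- **(packet) ⇒ (2) `BCDT.IsModular W`** from {C_A, Saito leaf of `W`, SteinbergSignPacket}. Replaces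
`isNewformOf_of_packet_off_level_of_carayolEuler hCE` + `hC` in k2 gen-4's
`isModular_of_isModularGaloisRepTate_two_primes` / `sigThreeImpTwoFreyCS_of_carayolEuler_of_freyLevel`.
[cite: BCDTJAMS2001, Introduction ((3) ⇒ (2))] -/
theorem isModular_of_packet_of_carayol1986_of_saito_of_sign (hC : Carayol1986_artinConductorExponent)
    (hSign : SteinbergSignPacket) (W : WeierstrassCurve ℚ) [W.IsElliptic] [NeZero (W.conductorNorm ℤ)]
    (hS : ∀ (ℓ : ℕ) [Fact ℓ.Prime],
      W.swanConductorAt_rationalTate_eq_wildConductorExponent_of_ringChar_eq_two ℓ)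
    {N : ℕ} [NeZero N] (f₀ : CuspForm (Gamma0 N) 2) (hf₀ : IsNewform0 f₀)
    (hgood : ∀ v : HeightOneSpectrum (𝓞 ℚ), ¬ ((primesEquiv v : ℕ) ∣ N) → W.HasGoodReductionAt v)
    (hap : ∀ p : ℕ, p.Prime → ¬ p ∣ N → cuspCoeff f₀ p = (W.LFunction p : ℂ)) :
    BCDT.IsModular W := by
  obtain ⟨hWf, hN⟩ :=
    isNewformOf_of_packet_of_carayol1986_of_saito_of_sign hC hSign W hS f₀ hf₀ hgood hap
  subst hN
  exact ⟨f₀, hWf⟩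

/-- **The realisation leaf in packet shape** (`hPk`): a modular `ρ_{W,ℓ}` yields the a.e. packet OFF ITS
LEVEL (hole at `ℓ` filled).  k2 gen 4 PROVES it under the compatible-system cut from two primes

Eichler–Shimura-weak / CR + hole-filler. [cite: BCDTJAMS2001, Introduction ((3) ⇒ (2))] -/
def SomeLevelPacket : Prop :=
  ∀ (W : WeierstrassCurve ℚ) [W.IsElliptic] (ℓ : ℕ) [Fact ℓ.Prime], W.IsModularGaloisRepTate ℓ →
    ∃ (N : ℕ) (_ : NeZero N) (f₀ : CuspForm (Gamma0 N) 2), IsNewform0 f₀ ∧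
      (∀ v : HeightOneSpectrum (𝓞 ℚ), ¬ ((primesEquiv v : ℕ) ∣ N) → W.HasGoodReductionAt v) ∧
      ∀ p : ℕ, p.Prime → ¬ p ∣ N → cuspCoeff f₀ p = (W.LFunction p : ℂ)

/-- **Plan closer — the VERBATIM stub `stub_threeImpTwo` from the four leaves**
{`SomeLevelPacket`, Carayol (A), Saito's `p = 2` leaf (all curves; ⇐ gen-4 k3's `SaitoTwoSupersingular`
by `saito_two_of_saitoTwoSupersingular`), `SteinbergSignPacket`}.
[cite: BCDTJAMS2001, Introduction ((3) ⇒ (2))] [cite: CarayolASENS1986, Thm. (A)] -/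
theorem stub_threeImpTwo_of_packet_leaves (hPk : SomeLevelPacket)
    (hC : Carayol1986_artinConductorExponent)
    (hS : ∀ (V : WeierstrassCurve ℚ) (ℓ : ℕ) [Fact ℓ.Prime],
      V.swanConductorAt_rationalTate_eq_wildConductorExponent_of_ringChar_eq_two ℓ)
    (hSign : SteinbergSignPacket) :
    ∀ (W : WeierstrassCurve ℚ) [W.IsElliptic] [NeZero (W.conductorNorm ℤ)] (ℓ : ℕ) [Fact ℓ.Prime],
      W.IsModularGaloisRepTate ℓ → BCDT.IsModular W := by
  intro W _ _ ℓ _ h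
  obtain ⟨N, hN, f₀, hf₀, hgood, hap⟩ := hPk W ℓ h
  exact isModular_of_packet_of_carayol1986_of_saito_of_sign hC hSign W (hS W) f₀ hf₀ hgood hap

/-- **The two-prime merge (M0 + M1): no hole.**  If `ρ_{E,ℓ₁}` and `ρ_{E,ℓ₂}` are modular for two
distinct primes, ONE newform `f₀ ∈ S₂(Γ₀(N))` carries `a_p(E)` for EVERY `p ∤ N`, and `E` is
good off `N`: the hole of each packet at its own prime is covered by the other packet. -/
theorem exists_isNewform0_packet_off_level_of_two_primes (W : WeierstrassCurve ℚ) [W.IsElliptic]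
    (ℓ₁ ℓ₂ : ℕ) [Fact ℓ₁.Prime] [Fact ℓ₂.Prime] (hne : ℓ₁ ≠ ℓ₂)
    (h₁ : W.IsModularGaloisRepTate ℓ₁) (h₂ : W.IsModularGaloisRepTate ℓ₂) :
    ∃ (N : ℕ) (_ : NeZero N) (f₀ : CuspForm (Gamma0 N) 2), IsNewform0 f₀ ∧
      (∀ v : HeightOneSpectrum (𝓞 ℚ), ¬ ((primesEquiv v : ℕ) ∣ N) → W.HasGoodReductionAt v) ∧
      ∀ p : ℕ, p.Prime → ¬ p ∣ N → cuspCoeff f₀ p = (W.LFunction p : ℂ) := by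
  have hℓ₁ : ℓ₁.Prime := Fact.out
  have hℓ₂ : ℓ₂.Prime := Fact.out
  obtain ⟨N₁, hN₁, f₁, hf₁, hgood₁, hap₁⟩ :=
    exists_isNewform0_hasGoodReductionAt_of_isModularGaloisRepTate W ℓ₁ h₁
  obtain ⟨N₂, hN₂, f₂, hf₂, hgood₂, hap₂⟩ :=
    exists_isNewform0_hasGoodReductionAt_of_isModularGaloisRepTate W ℓ₂ h₂
  have hM : N₁ * ℓ₁ * (N₂ * ℓ₂) ≠ 0 :=
    mul_ne_zero (mul_ne_zero (NeZero.ne N₁) hℓ₁.ne_zero) (mul_ne_zero (NeZero.ne N₂) hℓ₂.ne_zero)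
  have hagree : ∀ p : ℕ, p.Prime → ¬ p ∣ N₁ * ℓ₁ * (N₂ * ℓ₂) →
      cuspCoeff f₁ p = cuspCoeff f₂ p := by
    intro p hp hpM
    rw [hap₁ p hp fun h ↦ hpM (dvd_mul_of_dvd_left h _),
      hap₂ p hp fun h ↦ hpM (dvd_mul_of_dvd_right h _)]
  obtain ⟨hN, hcoeff⟩ := level_eq_and_cuspCoeff_eq_of_cuspCoeff_eq_off hf₁ hf₂ hM hagree
  subst hN
  refine ⟨N₁, hN₁, f₁, hf₁, fun v hv ↦ ?_, fun p hp hpN ↦ ?_⟩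
  · by_cases hv₁ : (primesEquiv v : ℕ) ∣ N₁ * ℓ₁
    · refine hgood₂ v fun hv₂ ↦ ?_
      have hq : (primesEquiv v : ℕ).Prime := (primesEquiv v).2
      have h1 : (primesEquiv v : ℕ) = ℓ₁ :=
        (Nat.prime_dvd_prime_iff_eq hq hℓ₁).mp ((hq.dvd_mul.mp hv₁).resolve_left hv)
      have h2 : (primesEquiv v : ℕ) = ℓ₂ :=
        (Nat.prime_dvd_prime_iff_eq hq hℓ₂).mp ((hq.dvd_mul.mp hv₂).resolve_left hv)
      exact hne (h1.symm.trans h2)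
    · exact hgood₁ v hv₁
  · by_cases hp₁ : p ∣ N₁ * ℓ₁
    · have h1 : p = ℓ₁ :=
        (Nat.prime_dvd_prime_iff_eq hp hℓ₁).mp ((hp.dvd_mul.mp hp₁).resolve_left hpN)
      have hp₂ : ¬ p ∣ N₁ * ℓ₂ := fun h' ↦ hne (h1.symm.trans
        ((Nat.prime_dvd_prime_iff_eq hp hℓ₂).mp ((hp.dvd_mul.mp h').resolve_left hpN)))
      rw [hcoeff p]
      exact hap₂ p hp hp₂
    · exact hap₁ p hp hp₁

/-- **`h32CS ⇐ {C_A, Saito-at-2 ∀V, Newform0SteinbergCoinvariants}`** — (3)+(3′) ⇒ (2) for EVERY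
elliptic curve from the packets at `3` and `5` (merge: no `ℓ`-hole), level by C_A + Saito, sign by the
residual.  No `Carayol1986_eulerFactor`, no `IsNewformOf.level_eq_conductorNorm`, no Eichler–Shimura.
[cite: BCDTJAMS2001, Introduction ((3) ⇒ (2))] [cite: CarayolASENS1986, Thm. (A)] -/
theorem sigThreeImpTwoCS_of_carayolA_of_saito_of_residual (hC : Carayol1986_artinConductorExponent)
    (hS : ∀ (V : WeierstrassCurve ℚ) (ℓ : ℕ) [Fact ℓ.Prime],
      V.swanConductorAt_rationalTate_eq_wildConductorExponent_of_ringChar_eq_two ℓ)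
    (hSC : Newform0SteinbergCoinvariants) : SigThreeImpTwoCS := by
  intro W _ _ h
  haveI : Fact (Nat.Prime 3) := ⟨Nat.prime_three⟩
  obtain ⟨N, hN, f₀, hf₀, hgood, hap⟩ :=
    exists_isNewform0_packet_off_level_of_two_primes W 3 5 (by decide) (h 3) (h 5)
  exact isModular_of_packet_of_carayol1986_of_saito_of_sign hC
    (steinbergSignPacket_of_newform0SteinbergCoinvariants hSC) W (hS W) f₀ hf₀ hgood hap

/-- **`h32FCS ⇐ {C_A, Newform0SteinbergCoinvariants, FreySaitoTwo}`** on the Frey family (consumers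
I1, I3), the CM corner `|ab(a+b)| = 2` (`32a2`, `j = 1728`) by the LANDED
`Summit.ABC.ABC.Theorems.isModular_freyCurve_of_natAbs_eq_two`.
[cite: BCDTJAMS2001, Introduction ((3) ⇒ (2))] [cite: DiamondKramer1995, Lemma 2] -/
theorem sigThreeImpTwoFreyCS_of_carayolA_of_residual_of_freySaito
    (hC : Carayol1986_artinConductorExponent) (hSC : Newform0SteinbergCoinvariants)
    (hFS : FreySaitoTwo) : SigThreeImpTwoFreyCS := by
  intro a b hab h0 _ _ h
  haveI : Fact (Nat.Prime 3) := ⟨Nat.prime_three⟩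
  by_cases h2 : (a * b * (a + b)).natAbs = 2
  · exact Summit.ABC.ABC.Theorems.isModular_freyCurve_of_natAbs_eq_two h2
  obtain ⟨N, hN, f₀, hf₀, hgood, hap⟩ :=
    exists_isNewform0_packet_off_level_of_two_primes (freyCurve a b) 3 5 (by decide) (h 3) (h 5)
  exact isModular_of_packet_of_carayol1986_of_saito_of_sign hC
    (steinbergSignPacket_of_newform0SteinbergCoinvariants hSC) (freyCurve a b) (hFS a b hab h0 h2)
    f₀ hf₀ hgood hap

end Closers

/-- **I2 at torsion level, NO named fact**: Tate-modular at every prime ⇒ every framed model of every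
`E[ℓ]` is modular (M2 at the torsion prime itself). -/
theorem isModular_torsion_of_isModularGaloisRepTateAll (W : WeierstrassCurve ℚ) [W.IsElliptic]
    (h : IsModularGaloisRepTateAll W) {ℓ : ℕ} [Fact ℓ.Prime] {ρ : ModPGaloisRep ℚ (ZMod ℓ) 2}
    (hρ : W.IsTorsionGaloisRep ℓ ρ) : ρ.IsModular :=
  isModular_torsion_of_isModularGaloisRepTate_self W ℓ (h ℓ) hρ

/-! ## The recut composition (kernel-checked): S9 never applied to the switched curve -/

/-- **Every Frey curve is modular from the CS-RECUT stub set** `{S1a, S1b-CS, S2-CS, h32FCS, S3}`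
(plus the skeleton's Frey inputs `h4a`, `h4b`, `h6`, `h9`, `h25`): CDT 1999, proof of Thm. 7.1.2
(p. 556), with the modularity of `ρ̄_{E,5} = ρ̄_{W',5}` read off `W'` Tate-modular AT `5` (M2) —
no `BCDT.IsModular W'`, hence no Carayol / Eichler–Shimura for the arbitrary-conductor curve `W'`. -/
theorem isModular_freyCurve_of_recutCS
    (hmod3 : ∀ (W : WeierstrassCurve ℚ) [W.IsElliptic] (ρ : ModPGaloisRep ℚ (ZMod 3) 2),
      W.IsTorsionGaloisRep 3 ρ → FramedRep.IsAbsolutelyIrreducible ρ → ρ.IsModular)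
    (hlift3 : SigLiftThreeCS) (hlift5 : SigLiftFiveCS) (h32 : SigThreeImpTwoFreyCS)
    (h3 : ∀ (W : WeierstrassCurve ℚ) [W.IsElliptic], ¬ 27 ∣ W.conductorNorm ℤ →
      (∀ ρ₃ : ModPGaloisRep ℚ (ZMod 3) 2, W.IsTorsionGaloisRep 3 ρ₃ →
        ¬ ρ₃.IsAbsIrreducibleOverSqrt (-3)) →
      ∀ (ρ : ModPGaloisRep ℚ (ZMod 5) 2), W.IsTorsionGaloisRep 5 ρ → ρ.IsAbsIrreducibleOverSqrt 5 →
      ∃ (W' : WeierstrassCurve ℚ) (_ : W'.IsElliptic), W'.IsTorsionGaloisRep 5 ρ ∧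
        ∃ ρ₃' : ModPGaloisRep ℚ (ZMod 3) 2, W'.IsTorsionGaloisRep 3 ρ₃' ∧
          ρ₃'.IsAbsIrreducibleOverSqrt (-3))
    (h4a : ∀ a b : ℤ, IsCoprime a b → a * b * (a + b) ≠ 0 →
      ∀ ρ : ModPGaloisRep ℚ (ZMod 5) 2, (freyCurve a b).IsTorsionGaloisRep 5 ρ →
        FramedRep.IsIrreducible ρ)
    (h4b : ∀ (W : WeierstrassCurve ℚ) [W.IsElliptic], ¬ 25 ∣ W.conductorNorm ℤ →
      ∀ ρ : ModPGaloisRep ℚ (ZMod 5) 2, W.IsTorsionGaloisRep 5 ρ →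
        FramedRep.IsIrreducible ρ → ρ.IsAbsIrreducibleOverSqrt 5)
    (h6 : ∀ (W W' : WeierstrassCurve ℚ) [W.IsElliptic] [W'.IsElliptic]
      (ρ : ModPGaloisRep ℚ (ZMod 5) 2),
      W.IsTorsionGaloisRep 5 ρ → W'.IsTorsionGaloisRep 5 ρ →
      ¬ 9 ∣ W.conductorNorm ℤ → ¬ 9 ∣ W'.conductorNorm ℤ)
    {a b : ℤ} (hab : IsCoprime a b) (h0 : a * b * (a + b) ≠ 0)
    [NeZero ((freyCurve a b).conductorNorm ℤ)]
    (h9 : ¬ 9 ∣ (freyCurve a b).conductorNorm ℤ) (h25 : ¬ 25 ∣ (freyCurve a b).conductorNorm ℤ) :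
    BCDT.IsModular (freyCurve a b) := by
  haveI := isElliptic_freyCurve h0
  -- case A: `ρ̄_{E,3}|ℚ(√-3)` absolutely irreducible for some framed model — S1a + S1b-CS + h32FCS
  by_cases hA : ∃ ρ₃ : ModPGaloisRep ℚ (ZMod 3) 2,
      (freyCurve a b).IsTorsionGaloisRep 3 ρ₃ ∧ ρ₃.IsAbsIrreducibleOverSqrt (-3)
  · obtain ⟨ρ₃, hρ₃, h3i⟩ := hA
    exact h32 a b hab h0
      (hlift3 (freyCurve a b) ρ₃ hρ₃ h3i h9
        (hmod3 (freyCurve a b) ρ₃ hρ₃ h3i.isAbsolutelyIrreducible))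
  -- case B
  have hB : ∀ ρ₃ : ModPGaloisRep ℚ (ZMod 3) 2, (freyCurve a b).IsTorsionGaloisRep 3 ρ₃ →
      ¬ ρ₃.IsAbsIrreducibleOverSqrt (-3) := fun ρ₃ hρ₃ h3i ↦ hA ⟨ρ₃, hρ₃, h3i⟩
  have h27 : ¬ 27 ∣ (freyCurve a b).conductorNorm ℤ := fun h27 ↦ h9 (dvd_trans ⟨3, rfl⟩ h27)
  obtain ⟨ρ, hρ⟩ := (freyCurve a b).exists_isTorsionGaloisRep 5
  have hirr : FramedRep.IsIrreducible ρ := h4a a b hab h0 ρ hρ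
  have h5 : ρ.IsAbsIrreducibleOverSqrt 5 := h4b (freyCurve a b) h25 ρ hρ hirr
  -- the `3`–`5` switch
  obtain ⟨W', hW', hρ', ρ₃', hρ₃', h3i'⟩ := h3 (freyCurve a b) h27 hB ρ hρ h5
  haveI := hW'
  have h9' : ¬ 9 ∣ W'.conductorNorm ℤ := h6 (freyCurve a b) W' ρ hρ hρ' h9
  -- `W'` is Tate-modular at EVERY prime (S1a + S1b-CS) …
  have hall' : IsModularGaloisRepTateAll W' :=
    hlift3 W' ρ₃' hρ₃' h3i' h9' (hmod3 W' ρ₃' hρ₃' h3i'.isAbsolutelyIrreducible)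
  -- … in particular at `5`, so `ρ̄ = ρ̄_{E,5} = ρ̄_{W',5}` is modular (M2; no (3) ⇒ (2) for `W'`)
  have hρmod : ρ.IsModular := isModular_torsion_of_isModularGaloisRepTateAll W' hall' hρ'
  -- and `E` is modular by S2-CS + h32FCS
  exact h32 a b hab h0 (hlift5 (freyCurve a b) ρ hρ h5 h25 hρmod)

/-- **The crux BY NAME from the CS-recut stubs** (via the landed iff
`freyModularity_iff_forall_isModular_freyCurve`; `h9`, `h25` from the landed
`not_nine_dvd_conductorNorm_freyCurve` and the skeleton's `not_twentyFive_dvd_conductorNorm_freyCurve`). -/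
theorem freyModularity_of_recutCS
    (hmod3 : ∀ (W : WeierstrassCurve ℚ) [W.IsElliptic] (ρ : ModPGaloisRep ℚ (ZMod 3) 2),
      W.IsTorsionGaloisRep 3 ρ → FramedRep.IsAbsolutelyIrreducible ρ → ρ.IsModular)
    (hlift3 : SigLiftThreeCS) (hlift5 : SigLiftFiveCS) (h32 : SigThreeImpTwoFreyCS)
    (h3 : CDT_three_five_switch)
    (h4a : ∀ a b : ℤ, IsCoprime a b → a * b * (a + b) ≠ 0 →
      ∀ ρ : ModPGaloisRep ℚ (ZMod 5) 2, (freyCurve a b).IsTorsionGaloisRep 5 ρ →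
        FramedRep.IsIrreducible ρ)
    (h4b : ∀ (W : WeierstrassCurve ℚ) [W.IsElliptic], ¬ 25 ∣ W.conductorNorm ℤ →
      ∀ ρ : ModPGaloisRep ℚ (ZMod 5) 2, W.IsTorsionGaloisRep 5 ρ →
        FramedRep.IsIrreducible ρ → ρ.IsAbsIrreducibleOverSqrt 5)
    (h6 : ∀ (W W' : WeierstrassCurve ℚ) [W.IsElliptic] [W'.IsElliptic]
      (ρ : ModPGaloisRep ℚ (ZMod 5) 2),
      W.IsTorsionGaloisRep 5 ρ → W'.IsTorsionGaloisRep 5 ρ →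
      ¬ 9 ∣ W.conductorNorm ℤ → ¬ 9 ∣ W'.conductorNorm ℤ)
    (h25 : ∀ a b : ℤ, IsCoprime a b → a * b * (a + b) ≠ 0 →
      ¬ 25 ∣ (freyCurve a b).conductorNorm ℤ) :
    Summit.ABC.ABC.Theses.DefiniteXi.FreyModularity :=
  Summit.ABC.ABC.Theorems.freyModularity_iff_forall_isModular_freyCurve.mpr
    fun _ _ hab h0 _ ↦ isModular_freyCurve_of_recutCS hmod3 hlift3 hlift5 h32 h3 h4a h4b h6 hab h0
      (Summit.ABC.ABC.Theorems.not_nine_dvd_conductorNorm_freyCurve hab h0) (h25 _ _ hab h0)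

/-- **Closing set of the gen-6 line (kernel-checked)** — four catalogued named facts + Carayol's
CONDUCTOR theorem (C_A) + the restricted Euler-factor residual `Newform0SteinbergCoinvariants`
(DDT 3.1 (e) at `p ∥ N`) + Saito's leaf on the Frey family (`FreySaitoTwo`, PROVED in k3 gen 3's
companion from a landed Theorems decl); NO `Carayol1986_eulerFactor`, NO ∀W level fact, NO
Eichler–Shimura, NO `L_A`.  Frey binders `h4a`/`h4b`/`h6`/`h25` are the skeleton's LANDED inputs
(`isIrreducible_freyCurve_five`, `stub_absIrrSqrtFive`, `stub_nineTransfer`,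
`not_twentyFive_dvd_conductorNorm_freyCurve`), kept as binders only because their module chain is not
built on the current farm snapshot. -/
theorem freyModularity_of_recutCS_atoms_gen6
    (hLT : ∀ σ : FramedArtinRep ℚ 2, Literature.NumberTheory.Automorphic.langlands_tunnell σ)
    (h721 : CDT_theorem_7_2_1) (h722 : CDT_theorem_7_2_2) (hsw : CDT_three_five_switch)
    (hCA : Carayol1986_artinConductorExponent) (hSC : Newform0SteinbergCoinvariants)
    (hFS : FreySaitoTwo)
    (h4a : ∀ a b : ℤ, IsCoprime a b → a * b * (a + b) ≠ 0 →
      ∀ ρ : ModPGaloisRep ℚ (ZMod 5) 2, (freyCurve a b).IsTorsionGaloisRep 5 ρ →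
        FramedRep.IsIrreducible ρ)
    (h4b : ∀ (W : WeierstrassCurve ℚ) [W.IsElliptic], ¬ 25 ∣ W.conductorNorm ℤ →
      ∀ ρ : ModPGaloisRep ℚ (ZMod 5) 2, W.IsTorsionGaloisRep 5 ρ →
        FramedRep.IsIrreducible ρ → ρ.IsAbsIrreducibleOverSqrt 5)
    (h6 : ∀ (W W' : WeierstrassCurve ℚ) [W.IsElliptic] [W'.IsElliptic]
      (ρ : ModPGaloisRep ℚ (ZMod 5) 2),
      W.IsTorsionGaloisRep 5 ρ → W'.IsTorsionGaloisRep 5 ρ →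
      ¬ 9 ∣ W.conductorNorm ℤ → ¬ 9 ∣ W'.conductorNorm ℤ)
    (h25 : ∀ a b : ℤ, IsCoprime a b → a * b * (a + b) ≠ 0 →
      ¬ 25 ∣ (freyCurve a b).conductorNorm ℤ) :
    Summit.ABC.ABC.Theses.DefiniteXi.FreyModularity :=
  freyModularity_of_recutCS (modThree_of_langlands_tunnell hLT)
    (sigLiftThreeCS_of_CDT_theorem_7_2_1 h721) (sigLiftFiveCS_of_CDT_theorem_7_2_2 h722)
    (sigThreeImpTwoFreyCS_of_carayolA_of_residual_of_freySaito hCA hSC hFS) hsw h4a h4b h6 h25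

/-- The same with the UNRESTRICTED `Carayol1986_eulerFactor` in place of the residual (gen 5's closing
set minus `FreyLevelEqConductor`, which C_A + `FreySaitoTwo` now supply). -/
theorem freyModularity_of_recutCS_atoms_gen6'
    (hLT : ∀ σ : FramedArtinRep ℚ 2, Literature.NumberTheory.Automorphic.langlands_tunnell σ)
    (h721 : CDT_theorem_7_2_1) (h722 : CDT_theorem_7_2_2) (hsw : CDT_three_five_switch)
    (hCA : Carayol1986_artinConductorExponent) (hCE : Carayol1986_eulerFactor) (hFS : FreySaitoTwo)
    (h4a : ∀ a b : ℤ, IsCoprime a b → a * b * (a + b) ≠ 0 →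
      ∀ ρ : ModPGaloisRep ℚ (ZMod 5) 2, (freyCurve a b).IsTorsionGaloisRep 5 ρ →
        FramedRep.IsIrreducible ρ)
    (h4b : ∀ (W : WeierstrassCurve ℚ) [W.IsElliptic], ¬ 25 ∣ W.conductorNorm ℤ →
      ∀ ρ : ModPGaloisRep ℚ (ZMod 5) 2, W.IsTorsionGaloisRep 5 ρ →
        FramedRep.IsIrreducible ρ → ρ.IsAbsIrreducibleOverSqrt 5)
    (h6 : ∀ (W W' : WeierstrassCurve ℚ) [W.IsElliptic] [W'.IsElliptic]
      (ρ : ModPGaloisRep ℚ (ZMod 5) 2),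
      W.IsTorsionGaloisRep 5 ρ → W'.IsTorsionGaloisRep 5 ρ →
      ¬ 9 ∣ W.conductorNorm ℤ → ¬ 9 ∣ W'.conductorNorm ℤ)
    (h25 : ∀ a b : ℤ, IsCoprime a b → a * b * (a + b) ≠ 0 →
      ¬ 25 ∣ (freyCurve a b).conductorNorm ℤ) :
    Summit.ABC.ABC.Theses.DefiniteXi.FreyModularity :=
  freyModularity_of_recutCS_atoms_gen6 hLT h721 h722 hsw hCA
    (newform0SteinbergCoinvariants_of_carayol1986_eulerFactor hCE) hFS h4a h4b h6 h25


/-! ## `FreySaitoTwo` discharged (k3 gen 3's chain ∘ the landed odd-Swan theorem) -/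

/-- **`FreySaitoTwo` from the odd-Swan value** (Saito 1988 at the place `2` for every Frey curve off
the CM corner): k3 gen 3's `freySaito_forall`; its one input `FreySwanThreeOfTwoMul` is, binder for
binder, the LANDED `Summit.ABC.ABC.Theorems.swanConductorAt_torsion_three_freyCurve_of_two_mul`
(Theorems/DefiniteXiFreyModularityStubFreySwanOdd.lean:136) — kept as a binder only because that
module's import `ThreeTorsionSwanAtTwoClassD6C4C7M8R7M2R1Proofs` is unbuilt on the current farm
snapshot (rc 75 `stale:1439:unbuilt`, 2026-08-31). [cite: Saito1988, Cor. 2]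
[cite: DiamondKramer1995, Lemma 2] -/
theorem freySaitoTwo_of_freySwanThreeOfTwoMul (hOdd : FreySaitoPort.FreySwanThreeOfTwoMul) :
    FreySaitoTwo :=
  fun a b hab h0 h2 ℓ _ ↦ FreySaitoPort.freySaito_forall hOdd a b hab h0 h2 ℓ

/-- **Closing set of the gen-6 line, Frey-Saito reduced to the landed odd-Swan value
(kernel-checked):** `{LT, CDT 7.2.1, CDT 7.2.2, 3/5-switch, Carayol (A) conductor,
Newform0SteinbergCoinvariants}` + FIVE binders that are statements of LANDED Theorems decls
(`swanConductorAt_torsion_three_freyCurve_of_two_mul`, `isIrreducible_freyCurve_five`,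
`stub_absIrrSqrtFive`, `stub_nineTransfer`, `not_twentyFive_dvd_conductorNorm_freyCurve`).  The ONLY non-catalogued named residual is
`Newform0SteinbergCoinvariants` = DDT Thm 3.1 (e) (Deligne–Rapoport / Langlands) at `p ∥ N`. -/
theorem freyModularity_of_recutCS_atoms_gen6_final
    (hLT : ∀ σ : FramedArtinRep ℚ 2, Literature.NumberTheory.Automorphic.langlands_tunnell σ)
    (h721 : CDT_theorem_7_2_1) (h722 : CDT_theorem_7_2_2) (hsw : CDT_three_five_switch)
    (hCA : Carayol1986_artinConductorExponent) (hSC : Newform0SteinbergCoinvariants)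
    (hOdd : FreySaitoPort.FreySwanThreeOfTwoMul)
    (h4a : ∀ a b : ℤ, IsCoprime a b → a * b * (a + b) ≠ 0 →
      ∀ ρ : ModPGaloisRep ℚ (ZMod 5) 2, (freyCurve a b).IsTorsionGaloisRep 5 ρ →
        FramedRep.IsIrreducible ρ)
    (h4b : ∀ (W : WeierstrassCurve ℚ) [W.IsElliptic], ¬ 25 ∣ W.conductorNorm ℤ →
      ∀ ρ : ModPGaloisRep ℚ (ZMod 5) 2, W.IsTorsionGaloisRep 5 ρ →
        FramedRep.IsIrreducible ρ → ρ.IsAbsIrreducibleOverSqrt 5)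
    (h6 : ∀ (W W' : WeierstrassCurve ℚ) [W.IsElliptic] [W'.IsElliptic]
      (ρ : ModPGaloisRep ℚ (ZMod 5) 2),
      W.IsTorsionGaloisRep 5 ρ → W'.IsTorsionGaloisRep 5 ρ →
      ¬ 9 ∣ W.conductorNorm ℤ → ¬ 9 ∣ W'.conductorNorm ℤ)
    (h25 : ∀ a b : ℤ, IsCoprime a b → a * b * (a + b) ≠ 0 →
      ¬ 25 ∣ (freyCurve a b).conductorNorm ℤ) :
    Summit.ABC.ABC.Theses.DefiniteXi.FreyModularity :=
  freyModularity_of_recutCS_atoms_gen6 hLT h721 h722 hsw hCA hSC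
    (freySaitoTwo_of_freySwanThreeOfTwoMul hOdd) h4a h4b h6 h25


/-! ## The residual in k3 gen 6's normal form (`CarayolSteinbergGamma0`) — same statement -/

/-- k3 gen 6's G6a, verbatim (`STUB_IDEAS_stub_threeImpTwo_3g6_Sketch.lean` :432): the reversed
Frobenius characteristic polynomial on the inertia coinvariants at a Steinberg place `ℓ ∥ N` of the
representation attached to (the `Γ₁(N)`-lift of) a `Γ₀(N)`-newform `f₀` is `1 - a_ℓ(f₀) T`.
[cite: DarmonDiamondTaylor1995, Thm. 3.1 (e)] [cite: CarayolASENS1986, Thm. (A)] -/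
def CarayolSteinbergGamma0 : Prop :=
  ∀ {N : ℕ} [NeZero N] (f₀ : CuspForm (Gamma0 N) 2), IsNewform0 f₀ →
    ∀ (p : ℕ) [Fact p.Prime] (ι : PadicAlgCl p ≃+* ℂ) (ρ : FramedGaloisRep ℚ (PadicAlgCl p) 2),
      IsGaloisRepOfNewform1 (liftToGamma1 N 2 f₀)
        ((ι.symm : ℂ →+* PadicAlgCl p).comp (algebraMap (coeffCharField (liftToGamma1 N 2 f₀)) ℂ))
          {q | q ∣ N * p} ρ →
      ρ.toGaloisRep.IsIrreducible →
    ∀ ℓ : ℕ, ℓ.Prime → ℓ ≠ p → ℓ ∣ N → ¬ ℓ ^ 2 ∣ N →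
    ∀ w : HeightOneSpectrum (𝓞 ℚ), (ℓ : 𝓞 ℚ) ∈ w.asIdeal → ∀ 𝔔 ∈ w.primesAbove,
    ∀ σ : 𝔔.decompositionSubgroup (absoluteGaloisGroup ℚ),
      IsArithFrobAt (𝓞 ℚ) (σ : absoluteGaloisGroup ℚ) 𝔔 →
      (ρ.toGaloisRep.toInertiaCoinvariants 𝔔 σ).charpoly.reverse =
        1 - C (ι.symm (cuspCoeff f₀ ℓ)) * X

/-- **The two ideators' residuals are ONE statement**: `Newform0SteinbergCoinvariants` (C_E restricted
verbatim) `↔` `CarayolSteinbergGamma0` (k3's normal form) — `a_ℓ(lift f₀) = a_ℓ(f₀)`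
(`coe_liftToGamma1_holds`) and `χ_{lift f₀}(ℓ) = 0` at the non-unit `ℓ ∣ N`
(`nebentypus_liftToGamma1_holds`, `MulChar.map_nonunit`). -/
theorem newform0SteinbergCoinvariants_iff_carayolSteinbergGamma0 :
    Newform0SteinbergCoinvariants ↔ CarayolSteinbergGamma0 := by
  have key : ∀ {N : ℕ} [NeZero N] (f₀ : CuspForm (Gamma0 N) 2), IsNewform0 f₀ →
      ∀ (p : ℕ) [Fact p.Prime] (ι : PadicAlgCl p ≃+* ℂ) (ℓ : ℕ), ℓ.Prime → ℓ ∣ N →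
      (1 - C (ι.symm (cuspCoeff (liftToGamma1 N 2 f₀) ℓ)) * X +
          C (ι.symm ((nebentypus (liftToGamma1 N 2 f₀) (ℓ : ZMod N) : ℂ) *
            (ℓ : ℂ) ^ ((2 : ℤ) - 1))) * X ^ 2 : (PadicAlgCl p)[X]) =
        1 - C (ι.symm (cuspCoeff f₀ ℓ)) * X := by
    intro N _ f₀ hf₀ p _ ι ℓ hℓ hℓN
    have hne : f₀ ≠ 0 := ne_zero_of_isNewform0 f₀ hf₀
    have hcc : cuspCoeff (liftToGamma1 N 2 f₀) ℓ = cuspCoeff f₀ ℓ := by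
      rw [cuspCoeff, cuspCoeff, coe_liftToGamma1_holds N 2 f₀]
    have hε : nebentypus (liftToGamma1 N 2 f₀) (ℓ : ZMod N) = 0 := by
      rw [nebentypus_liftToGamma1_holds N 2 hne]
      exact MulChar.map_nonunit _ (mt (ZMod.isUnit_prime_iff_not_dvd hℓ).mp (not_not.mpr hℓN))
    rw [hcc, hε]
    simp
  constructor
  · intro h N _ f₀ hf₀ p _ ι ρ hρ hirr ℓ hℓ hℓp hℓN hℓ2 w hℓw 𝔔 h𝔔 σ hσ
    rw [h f₀ hf₀ p ι ρ hρ hirr ℓ hℓ hℓp hℓN hℓ2 w hℓw 𝔔 h𝔔 σ hσ, key f₀ hf₀ p ι ℓ hℓ hℓN]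
  · intro h N _ f₀ hf₀ p _ ι ρ hρ hirr ℓ hℓ hℓp hℓN hℓ2 w hℓw 𝔔 h𝔔 σ hσ
    rw [h f₀ hf₀ p ι ρ hρ hirr ℓ hℓ hℓp hℓN hℓ2 w hℓw 𝔔 h𝔔 σ hσ, key f₀ hf₀ p ι ℓ hℓ hℓN]

/-- The end-to-end closer consuming k3's normal form of the residual. -/
theorem freyModularity_of_recutCS_atoms_gen6_final'
    (hLT : ∀ σ : FramedArtinRep ℚ 2, Literature.NumberTheory.Automorphic.langlands_tunnell σ)
    (h721 : CDT_theorem_7_2_1) (h722 : CDT_theorem_7_2_2) (hsw : CDT_three_five_switch)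
    (hCA : Carayol1986_artinConductorExponent) (hCS : CarayolSteinbergGamma0)
    (hOdd : FreySaitoPort.FreySwanThreeOfTwoMul)
    (h4a : ∀ a b : ℤ, IsCoprime a b → a * b * (a + b) ≠ 0 →
      ∀ ρ : ModPGaloisRep ℚ (ZMod 5) 2, (freyCurve a b).IsTorsionGaloisRep 5 ρ →
        FramedRep.IsIrreducible ρ)
    (h4b : ∀ (W : WeierstrassCurve ℚ) [W.IsElliptic], ¬ 25 ∣ W.conductorNorm ℤ →
      ∀ ρ : ModPGaloisRep ℚ (ZMod 5) 2, W.IsTorsionGaloisRep 5 ρ →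
        FramedRep.IsIrreducible ρ → ρ.IsAbsIrreducibleOverSqrt 5)
    (h6 : ∀ (W W' : WeierstrassCurve ℚ) [W.IsElliptic] [W'.IsElliptic]
      (ρ : ModPGaloisRep ℚ (ZMod 5) 2),
      W.IsTorsionGaloisRep 5 ρ → W'.IsTorsionGaloisRep 5 ρ →
      ¬ 9 ∣ W.conductorNorm ℤ → ¬ 9 ∣ W'.conductorNorm ℤ)
    (h25 : ∀ a b : ℤ, IsCoprime a b → a * b * (a + b) ≠ 0 →
      ¬ 25 ∣ (freyCurve a b).conductorNorm ℤ) :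
    Summit.ABC.ABC.Theses.DefiniteXi.FreyModularity :=
  freyModularity_of_recutCS_atoms_gen6_final hLT h721 h722 hsw hCA
    (newform0SteinbergCoinvariants_iff_carayolSteinbergGamma0.mpr hCS) hOdd h4a h4b h6 h25

end Summit.ABC.ABC.Cruxes.FreyModularity.Sketch.StubIdeasThreeImpTwo2G6

end
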